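import Literature.NumberTheory.Transcendental.TwoCurveTheta
import Literature.NumberTheory.Transcendental.PkappaThetaLaws
import Literature.NumberTheory.Transcendental.PkappaLawFamily
import HarnessLib

/-!
# Addition laws of the theta model of the two-lattice standard models `M = 𝔾ₘ^β × P`

Topic `Literature/NumberTheory/Transcendental`; unit
`provefact-Literature.NumberTheory.Transcendental.H-a66b67e3eb` (fact
`Literature.NumberTheory.Transcendental.HuberWustholzTwoCurvePeriods`). It introduces NO named fact.
Two-lattice counterpart (first stage of the port of the discharge programme of Philippon's zero
estimate, `philippon1986_std`, to the two-lattice theta model of `TwoCurveTheta.lean`) of the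
one-lattice files `PkappaThetaAddition.lean`, `PkappaThetaAdditionPoly.lean`,
`PkappaLawFamily.lean` and `PkappaThetaLaws.lean`: the translation structure (addition laws in the
sense of Masser–Wüstholz 1981 §2 / D. Roy, LNM 1752 Ch. 11 §2.1) of the theta model of
`M = 𝔾ₘ^β × P`, `P` the push-out of the universal vectorial extension of `E^γ × E'^{γ'}` along `κ`,
every `E`-block `b ∈ γ ⊕ γ'` being computed with the lattice `Λ_b` of the block
(`GaGmEE.lat L L' b`). The chord law of the Weierstrass cubic and its companion
(`PeriodPair.chordA/B/C`, `chordCoeff₂`, `chordC₂`, `chord_companion`, `chordCoeff₂_swap`) are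
per-lattice facts of the tree, used blockwise.

## What is proved here (everything; no `sorry`, no new `def … : Prop`)

* `GaGmEE.Std.theta_add_none/some` — for ALL `w, u`:
  `μ(w,u) Θ_{(a,(M,none))}(w + u) = ∑_{J,K} T_a(u) c_{M;J,K}(u) Θ_{(a,(J,none))}(w) Θ_{(none,(K,none))}(w)`
  and its fibre-coordinate analogue, with the unit `μ(w,u) = ∏_b (-σ_{Λ_b}(z'_b - t'_b)³)`
  (`addUnit`, entire, non-zero off the block diagonals) and entire coefficients
  `addCoeffP/addCoeffS` (blockwise products of the chord coefficient forms of `Λ_b`);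
* `addPoly`, `translate`, `lawPoly`, `lawUnit` — the law as quadratic forms in `ℂ[X_J]`,
  translation of forms (`thetaEval_translate`: `P^{(u)}(Θ(w)) = μ(w,u)^D P(Θ(w+u))`), the composed
  law through an auxiliary point (`thetaEval_lawPoly`, degree `4`), holomorphy of all
  coefficients (`CoeffDifferentiable`, reused), `exists_analytic_addition_law`;
* `auxPt`, `exists_lawUnit_auxPt_ne_zero` — a FINITE complete family: `2|γ ⊕ γ'| + 1` auxiliary
  points built from the generic shifts `ω₁(Λ_b)/(4|γ ⊕ γ'| + 3)` of the block lattices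
  (`GaGmE.Std.genericShift`, reused blockwise);
* `lawA`, `lawB`, `addCoeffP_eq_sum`, `addCoeffS_eq_sum`, `theta_add_none₂/some₂`, `bilaw`,
  `eval_bilaw`, `claw`, `clawUnit`, `eval_claw`, `claw_isWeightedHomogeneous(_wY)`,
  `analyticOnNhd_clawUnit` — the bihomogeneous `(2,2)` law with CONSTANT coefficients and the
  composite laws of degree `4` in `X` (Roy §2.1 (84));
* `exists_generic_scalar` (one scalar generic for both lattices), `exists_clawUnit_clawPt_ne_zero`
  (pigeonhole over (block, failure type)), `clawScalar`, `clawFamily`,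
  `exists_clawUnit_clawFamily_ne_zero`, `exists_complete_addition_laws` — completeness with
  `3|γ ⊕ γ'| + 1` laws, in the shape of the fields of `AnalyticGroupModel` (`ZeroEstModel.lean`).

Generic one-lattice material reused verbatim: `prod_sum_sum_eq`, `eval_smul_of_isHomogeneous`,
`eval_bind₁`, `CoeffDifferentiable.*`, the weighted-homogeneity lemmas (`wX`, `wY`, …),
`GaGmE.Std.thetaT(_add)`, `genericShift`, `intCast_mul_genericShift_notMem`, `clawPt`, `nClaw`.

## References

* D. W. Masser, G. Wüstholz, *Zero estimates on group varieties I*, Invent. Math. 64 (1981),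
  489–516, §2 (addition laws, complete systems). [MasserWustholz1981]
* Yu. V. Nesterenko, P. Philippon (eds.), *Introduction to Algebraic Independence Theory*,
  LNM 1752, Springer 2001, Ch. 11 (D. Roy), §2.1 (84), Prop. 3.6 (iv). [NesterenkoPhilippon2001]
* H. Lange, W. Ruppert, *Complete systems of addition laws on abelian varieties*, Invent. Math.
  79 (1985), 603–610. [LangeRuppert1985]
* P. Philippon, *Lemmes de zéros dans les groupes algébriques commutatifs*, Bull. Soc. Math.
  France 114 (1986), 355–383, §2, Thm. 2.1. [Philippon1986]
* A. Huber, G. Wüstholz, *Transcendence and Linear Relations of 1-Periods*, CUP 2022, Thm. 15.3.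
  [HuberWustholz2022]
-/

noncomputable section

open Complex MvPolynomial Set
open scoped PeriodPair

namespace Literature.NumberTheory.Transcendental

/-! ## The addition law (port of `PkappaThetaAddition.lean`) -/

namespace GaGmEE

namespace Std

open GaGmE (Kbar)
open GaGmE.Std (iy iz is coords coords_iy coords_iz coords_is ThetaIdx thetaT thetaT_none thetaT_some
  thetaT_add differentiable_thetaT differentiable_finset_prod genericShift intCast_mul_genericShift_notMem
  clawPt clawPt_iz nClaw)

variable {β γ γ' δ : Type} [Fintype β] [Fintype γ] [Fintype γ'] [Fintype δ] [DecidableEq γ] [DecidableEq γ']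
variable (L L' : PeriodPair) (κM : δ → γ ⊕ γ' → Kbar)

/-! ### Blocks, the unit and the coefficients of the law -/

/-- The `E`-block vector `(P₀, P₁, P₂)(z'_b)` of `w`. [folklore] -/
def blockP (w : β ⊕ ((γ ⊕ γ') ⊕ δ) → ℂ) (b : γ ⊕ γ') : Fin 3 → ℂ := fun j => (lat L L' b).univExtP j (w (iz b))

/-- The `ζ`-companion vector `(Z₀, Z₁, Z₂)(z'_b)` of `w`. [folklore] -/
def blockZ (w : β ⊕ ((γ ⊕ γ') ⊕ δ) → ℂ) (b : γ ⊕ γ') : Fin 3 → ℂ := fun j => (lat L L' b).univExtZ j (w (iz b))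

omit [Fintype β] [Fintype γ] [Fintype γ'] [Fintype δ] [DecidableEq γ] [DecidableEq γ'] in
/-- Components of the block vector. [folklore] -/
@[simp] theorem blockP_apply (w : β ⊕ ((γ ⊕ γ') ⊕ δ) → ℂ) (b : γ ⊕ γ') (j : Fin 3) :
    blockP L L' w b j = (lat L L' b).univExtP j (w (iz b)) := rfl

omit [Fintype β] [Fintype γ] [Fintype γ'] [Fintype δ] [DecidableEq γ] [DecidableEq γ'] in
/-- Components of the companion vector. [folklore] -/
@[simp] theorem blockZ_apply (w : β ⊕ ((γ ⊕ γ') ⊕ δ) → ℂ) (b : γ ⊕ γ') (j : Fin 3) :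
    blockZ L L' w b j = (lat L L' b).univExtZ j (w (iz b)) := rfl

/-- **The unit of the law**: `μ(w, u) = ∏_b (-σ(z'_b - t'_b)³)` (`z' = z`-block of `w`,
`t' = z`-block of `u`). [folklore] -/
def addUnit (w u : β ⊕ ((γ ⊕ γ') ⊕ δ) → ℂ) : ℂ :=
  ∏ b : γ ⊕ γ', -((lat L L' b).weierstrassSigma (w (iz b) - u (iz b)) ^ 3)

omit [Fintype β] [Fintype δ] [DecidableEq γ] [DecidableEq γ'] in
/-- `μ(w, u) ≠ 0` iff `w` and `u` are off all block diagonals: `z'_b - t'_b ∉ Λ` for all `b`.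
[folklore] -/
theorem addUnit_ne_zero_iff (w u : β ⊕ ((γ ⊕ γ') ⊕ δ) → ℂ) :
    addUnit (β := β) (δ := δ) L L' w u ≠ 0 ↔ ∀ b, w (iz b) - u (iz b) ∉ (lat L L' b).lattice := by
  rw [addUnit, Finset.prod_ne_zero_iff]
  simp only [Finset.mem_univ, true_implies, neg_ne_zero]
  exact forall_congr' fun b => (lat L L' b).sigma_sub_pow_ne_zero_iff _ _

/-- **The coefficients of the law on the blocks**:
`c_{M;J,K}(u) = ∏_b α^{(M_b)}_{J_b K_b}(P(t'_b))`. [folklore] -/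
def addCoeffP (M J K : γ ⊕ γ' → Fin 3) (u : β ⊕ ((γ ⊕ γ') ⊕ δ) → ℂ) : ℂ :=
  ∏ b, (lat L L' b).chordCoeff (M b) (J b) (K b) (blockP L L' u b)

/-- **The coefficients of the law on the fibre coordinates** (the part of the translate of a
fibre section that is a form in the block coordinates alone):
`d^{e}_{M;J,K}(u) = s_e(u) c_{M;J,K}(u) + ∑_b κ_{eb} (∑_{j,k} a^{(M_b)}_{jk;J_bK_b} Z_j(t'_b)P_k(t'_b)
  - γ^{(M_b)}_{J_bK_b}(P(t'_b))) ∏_{b'≠b} α^{(M_{b'})}_{J_{b'}K_{b'}}(P(t'_{b'}))`. [folklore] -/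
def addCoeffS (M : γ ⊕ γ' → Fin 3) (e : δ) (J K : γ ⊕ γ' → Fin 3) (u : β ⊕ ((γ ⊕ γ') ⊕ δ) → ℂ) : ℂ :=
  u (is e) * addCoeffP L L' M J K u +
    ∑ b, (κM e b : ℂ) *
      (((∑ j : Fin 3, ∑ k : Fin 3,
          (lat L L' b).chordCoeff₂ (M b) j k (J b) (K b) * (blockZ L L' u b j * blockP L L' u b k)) -
        (lat L L' b).chordCcoeff (M b) (J b) (K b) (blockP L L' u b)) *
      ∏ b' ∈ Finset.univ.erase b, (lat L L' b').chordCoeff (M b') (J b') (K b') (blockP L L' u b'))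

/-! ### The law on the products `Θ^P_{(M, none)}` -/

omit [Fintype β] [Fintype δ] [DecidableEq γ] [DecidableEq γ'] in
/-- `μ(w,u) · ∏_b P_{M_b}(z'_b + t'_b) = ∏_b A_{M_b}(P(z'_b), P(t'_b))`. [folklore] -/
theorem addUnit_mul_thetaPnone (M : γ ⊕ γ' → Fin 3) (w u : β ⊕ ((γ ⊕ γ') ⊕ δ) → ℂ) :
    addUnit (β := β) (δ := δ) L L' w u * thetaPnone (β := β) (δ := δ) L L' M (w + u) =
      ∏ b, (lat L L' b).chordA (M b) (blockP L L' w b) (blockP L L' u b) := by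
  unfold addUnit thetaPnone
  rw [← Finset.prod_mul_distrib]
  refine Finset.prod_congr rfl fun b _ => ?_
  rw [Pi.add_apply, show blockP L L' w b = fun j => (lat L L' b).univExtP j (w (iz b)) from rfl,
    show blockP L L' u b = fun j => (lat L L' b).univExtP j (u (iz b)) from rfl, (lat L L' b).chordA_univExtP]
  ring

omit [Fintype β] [Fintype δ] in
/-- **The addition law for `Θ^P_{(M, none)}`**:
`μ(w, u) Θ^P_{(M,none)}(w + u) = ∑_{J,K} c_{M;J,K}(u) Θ^P_{(J,none)}(w) Θ^P_{(K,none)}(w)`. [folklore] -/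
theorem thetaPnone_add (M : γ ⊕ γ' → Fin 3) (w u : β ⊕ ((γ ⊕ γ') ⊕ δ) → ℂ) :
    addUnit (β := β) (δ := δ) L L' w u * thetaPnone (β := β) (δ := δ) L L' M (w + u) =
      ∑ J : γ ⊕ γ' → Fin 3, ∑ K : γ ⊕ γ' → Fin 3,
        addCoeffP L L' M J K u * (thetaPnone (β := β) (δ := δ) L L' J w * thetaPnone (β := β) (δ := δ) L L' K w) := by
  rw [addUnit_mul_thetaPnone]
  simp only [PeriodPair.chordA]
  exact prod_sum_sum_eq (fun b j k => (lat L L' b).chordCoeff (M b) j k (blockP L L' u b)) (blockP L L' w) (blockP L L' w)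

/-! ### The law on the fibre sections `Θ^P_{(M, some e)}` -/

omit [Fintype β] [Fintype δ] in
/-- The unit times the `b`-th summand of a fibre section at `w + u`:
`μ · Z_{M_b}(z'_b+t'_b) ∏_{b'≠b} P_{M_{b'}}(z'_{b'}+t'_{b'}) = comp_b · ∏_{b'≠b} A_{M_{b'}}`, where
`comp_b = B(P(t'_b); Z(z'_b), P(z'_b)) - B(P(z'_b); Z(t'_b), P(t'_b)) + C(P(z'_b), P(t'_b))` is the
companion law of the block `b`. [folklore] -/
theorem addUnit_mul_companion_prod (M : γ ⊕ γ' → Fin 3) (w u : β ⊕ ((γ ⊕ γ') ⊕ δ) → ℂ) (b : γ ⊕ γ') :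
    addUnit (β := β) (δ := δ) L L' w u *
        ((lat L L' b).univExtZ (M b) ((w + u) (iz b)) *
          ∏ b' ∈ Finset.univ.erase b, (lat L L' b').univExtP (M b') ((w + u) (iz b'))) =
      ((lat L L' b).chordB (M b) (blockP L L' u b) (blockZ L L' w b) (blockP L L' w b) -
          (lat L L' b).chordB (M b) (blockP L L' w b) (blockZ L L' u b) (blockP L L' u b) +
          (lat L L' b).chordC (M b) (blockP L L' w b) (blockP L L' u b)) *
        ∏ b' ∈ Finset.univ.erase b, (lat L L' b').chordA (M b') (blockP L L' w b') (blockP L L' u b') := by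
  have hcomp : (lat L L' b).chordB (M b) (blockP L L' u b) (blockZ L L' w b) (blockP L L' w b) -
      (lat L L' b).chordB (M b) (blockP L L' w b) (blockZ L L' u b) (blockP L L' u b) +
      (lat L L' b).chordC (M b) (blockP L L' w b) (blockP L L' u b) =
      -((lat L L' b).weierstrassSigma (w (iz b) - u (iz b)) ^ 3 * (lat L L' b).univExtZ (M b) (w (iz b) + u (iz b))) :=
    (lat L L' b).chord_companion (M b) (w (iz b)) (u (iz b))
  have hA : ∀ b', (lat L L' b').chordA (M b') (blockP L L' w b') (blockP L L' u b') =
      -((lat L L' b').weierstrassSigma (w (iz b') - u (iz b')) ^ 3) * (lat L L' b').univExtP (M b') (w (iz b') + u (iz b')) := by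
    intro b'
    rw [show blockP L L' w b' = fun j => (lat L L' b').univExtP j (w (iz b')) from rfl,
      show blockP L L' u b' = fun j => (lat L L' b').univExtP j (u (iz b')) from rfl, (lat L L' b').chordA_univExtP]
    ring
  unfold addUnit
  rw [← Finset.mul_prod_erase Finset.univ _ (Finset.mem_univ b)]
  simp only [Pi.add_apply]
  rw [show ∏ b' ∈ Finset.univ.erase b, (lat L L' b').chordA (M b') (blockP L L' w b') (blockP L L' u b') =
      (∏ b' ∈ Finset.univ.erase b, -((lat L L' b').weierstrassSigma (w (iz b') - u (iz b')) ^ 3)) *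
        ∏ b' ∈ Finset.univ.erase b, (lat L L' b').univExtP (M b') (w (iz b') + u (iz b')) by
    rw [← Finset.prod_mul_distrib]; exact Finset.prod_congr rfl fun b' _ => hA b']
  linear_combination -(∏ b' ∈ Finset.univ.erase b, -((lat L L' b').weierstrassSigma (w (iz b') - u (iz b')) ^ 3)) *
    (∏ b' ∈ Finset.univ.erase b, (lat L L' b').univExtP (M b') (w (iz b') + u (iz b'))) * hcomp

omit [Fintype β] [Fintype δ] in
/-- Regrouping the companion-linear part of the `b`-th summand over the Segre monomials:
`B(P(t'_b); Z(z'_b), P(z'_b)) ∏_{b'≠b} A_{M_{b'}} = ∑_{J,K} c_{M;J,K}(u) (Z_{J_b}(z'_b) ∏_{b'≠b} P_{J_{b'}}(z'_{b'})) Θ^P_{(K,none)}(w)`.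
[folklore] -/
theorem chordB_mul_prod_chordA (M : γ ⊕ γ' → Fin 3) (w u : β ⊕ ((γ ⊕ γ') ⊕ δ) → ℂ) (b : γ ⊕ γ') :
    (lat L L' b).chordB (M b) (blockP L L' u b) (blockZ L L' w b) (blockP L L' w b) *
        ∏ b' ∈ Finset.univ.erase b, (lat L L' b').chordA (M b') (blockP L L' w b') (blockP L L' u b') =
      ∑ J : γ ⊕ γ' → Fin 3, ∑ K : γ ⊕ γ' → Fin 3, addCoeffP L L' M J K u *
        ((blockZ L L' w b (J b) * ∏ b' ∈ Finset.univ.erase b, blockP L L' w b' (J b')) *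
          ∏ b', blockP L L' w b' (K b')) := by
  set v : γ ⊕ γ' → Fin 3 → ℂ := fun b' => if b' = b then blockZ L L' w b else blockP L L' w b' with hv
  have key := prod_sum_sum_eq (fun b' j k => (lat L L' b').chordCoeff (M b') j k (blockP L L' u b')) v (blockP L L' w)
  have hvb : v b = blockZ L L' w b := by simp [hv]
  have hvb' : ∀ b' ∈ Finset.univ.erase b, v b' = blockP L L' w b' := fun b' hb' => by
    simp [hv, Finset.ne_of_mem_erase hb']
  have h1 : ∏ b', ∑ j : Fin 3, ∑ k : Fin 3, (lat L L' b').chordCoeff (M b') j k (blockP L L' u b') * (v b' j * blockP L L' w b' k) =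
      (lat L L' b).chordB (M b) (blockP L L' u b) (blockZ L L' w b) (blockP L L' w b) *
        ∏ b' ∈ Finset.univ.erase b, (lat L L' b').chordA (M b') (blockP L L' w b') (blockP L L' u b') := by
    rw [← Finset.mul_prod_erase Finset.univ _ (Finset.mem_univ b), hvb]
    congr 1
    exact Finset.prod_congr rfl fun b' hb' => by rw [hvb' b' hb']; rfl
  have h2 : ∀ J : γ ⊕ γ' → Fin 3, ∏ b', v b' (J b') =
      blockZ L L' w b (J b) * ∏ b' ∈ Finset.univ.erase b, blockP L L' w b' (J b') := fun J => by
    rw [← Finset.mul_prod_erase Finset.univ _ (Finset.mem_univ b), hvb]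
    congr 1
    exact Finset.prod_congr rfl fun b' hb' => by rw [hvb' b' hb']
  rw [← h1, key]
  simp only [h2]
  rfl

omit [Fintype β] [Fintype δ] in
/-- **The companion-linear part of the law**, summed over the blocks with the weights `κ_{eb}`:
it is `∑_{J,K} c_{M;J,K}(u) (∑_b κ_{eb} Z_{J_b} ∏_{b'≠b} P_{J_{b'}})(w) Θ^P_{(K,none)}(w)`. [folklore] -/
theorem sum_chordB_mul_prod_chordA (M : γ ⊕ γ' → Fin 3) (e : δ) (w u : β ⊕ ((γ ⊕ γ') ⊕ δ) → ℂ) :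
    ∑ b, (κM e b : ℂ) * ((lat L L' b).chordB (M b) (blockP L L' u b) (blockZ L L' w b) (blockP L L' w b) *
        ∏ b' ∈ Finset.univ.erase b, (lat L L' b').chordA (M b') (blockP L L' w b') (blockP L L' u b')) =
      ∑ J : γ ⊕ γ' → Fin 3, ∑ K : γ ⊕ γ' → Fin 3, addCoeffP L L' M J K u *
        ((∑ b, (κM e b : ℂ) * ((lat L L' b).univExtZ (J b) (w (iz b)) *
            ∏ b' ∈ Finset.univ.erase b, (lat L L' b').univExtP (J b') (w (iz b')))) *
          thetaPnone (β := β) (δ := δ) L L' K w) := by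
  simp only [chordB_mul_prod_chordA, blockZ_apply, blockP_apply, thetaPnone, Finset.mul_sum,
    Finset.sum_mul]
  rw [Finset.sum_comm]
  refine Finset.sum_congr rfl fun J _ => ?_
  rw [Finset.sum_comm]
  refine Finset.sum_congr rfl fun K _ => Finset.sum_congr rfl fun b _ => ?_
  ring

omit [Fintype β] [Fintype δ] in
/-- Regrouping the remaining part of the `b`-th summand (companions of `u` and the correction)
over the Segre monomials of `w`. [folklore] -/
theorem rest_mul_prod_chordA (M : γ ⊕ γ' → Fin 3) (w u : β ⊕ ((γ ⊕ γ') ⊕ δ) → ℂ) (b : γ ⊕ γ') :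
    ((lat L L' b).chordB (M b) (blockP L L' w b) (blockZ L L' u b) (blockP L L' u b) -
          (lat L L' b).chordC (M b) (blockP L L' w b) (blockP L L' u b)) *
        ∏ b' ∈ Finset.univ.erase b, (lat L L' b').chordA (M b') (blockP L L' w b') (blockP L L' u b') =
      ∑ J : γ ⊕ γ' → Fin 3, ∑ K : γ ⊕ γ' → Fin 3,
        (((∑ j : Fin 3, ∑ k : Fin 3,
              (lat L L' b).chordCoeff₂ (M b) j k (J b) (K b) * (blockZ L L' u b j * blockP L L' u b k)) -
            (lat L L' b).chordCcoeff (M b) (J b) (K b) (blockP L L' u b)) *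
          ∏ b' ∈ Finset.univ.erase b, (lat L L' b').chordCoeff (M b') (J b') (K b') (blockP L L' u b')) *
        (thetaPnone (β := β) (δ := δ) L L' J w * thetaPnone (β := β) (δ := δ) L L' K w) := by
  set D : Fin 3 → Fin 3 → ℂ := fun l m =>
    (∑ j : Fin 3, ∑ k : Fin 3, (lat L L' b).chordCoeff₂ (M b) j k l m * (blockZ L L' u b j * blockP L L' u b k)) -
      (lat L L' b).chordCcoeff (M b) l m (blockP L L' u b) with hD
  set a : γ ⊕ γ' → Fin 3 → Fin 3 → ℂ := fun b' l m =>
    if b' = b then D l m else (lat L L' b').chordCoeff (M b') l m (blockP L L' u b') with ha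
  have key := prod_sum_sum_eq a (blockP L L' w) (blockP L L' w)
  have hab : a b = D := by funext l m; simp [ha]
  have hab' : ∀ b' ∈ Finset.univ.erase b, a b' = fun l m => (lat L L' b').chordCoeff (M b') l m (blockP L L' u b') :=
    fun b' hb' => by funext l m; simp [ha, Finset.ne_of_mem_erase hb']
  have hDsum : ∑ l : Fin 3, ∑ m : Fin 3, D l m * (blockP L L' w b l * blockP L L' w b m) =
      (lat L L' b).chordB (M b) (blockP L L' w b) (blockZ L L' u b) (blockP L L' u b) -
        (lat L L' b).chordC (M b) (blockP L L' w b) (blockP L L' u b) := by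
    rw [(lat L L' b).chordB_eq_sum_left, (lat L L' b).chordC_eq_sum, ← Finset.sum_sub_distrib]
    refine Finset.sum_congr rfl fun l _ => ?_
    rw [← Finset.sum_sub_distrib]
    refine Finset.sum_congr rfl fun m _ => ?_
    rw [hD]
    ring
  have h1 : ∏ b', ∑ l : Fin 3, ∑ m : Fin 3, a b' l m * (blockP L L' w b' l * blockP L L' w b' m) =
      ((lat L L' b).chordB (M b) (blockP L L' w b) (blockZ L L' u b) (blockP L L' u b) -
          (lat L L' b).chordC (M b) (blockP L L' w b) (blockP L L' u b)) *
        ∏ b' ∈ Finset.univ.erase b, (lat L L' b').chordA (M b') (blockP L L' w b') (blockP L L' u b') := by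
    rw [← Finset.mul_prod_erase Finset.univ _ (Finset.mem_univ b), hab, hDsum]
    congr 1
    exact Finset.prod_congr rfl fun b' hb' => by rw [hab' b' hb']; rfl
  have h2 : ∀ J K : γ ⊕ γ' → Fin 3, ∏ b', a b' (J b') (K b') =
      D (J b) (K b) * ∏ b' ∈ Finset.univ.erase b, (lat L L' b').chordCoeff (M b') (J b') (K b') (blockP L L' u b') :=
    fun J K => by
    rw [← Finset.mul_prod_erase Finset.univ _ (Finset.mem_univ b), hab]
    congr 1
    exact Finset.prod_congr rfl fun b' hb' => by rw [hab' b' hb']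
  rw [← h1, key]
  simp only [h2]
  rfl

omit [Fintype β] [Fintype δ] in
/-- **The remaining part of the law**, summed over the blocks with the weights `κ_{eb}`: it is
`∑_{J,K} (d^e_{M;J,K}(u) - s_e(u) c_{M;J,K}(u)) Θ^P_{(J,none)}(w) Θ^P_{(K,none)}(w)`. [folklore] -/
theorem sum_rest_mul_prod_chordA (M : γ ⊕ γ' → Fin 3) (e : δ) (w u : β ⊕ ((γ ⊕ γ') ⊕ δ) → ℂ) :
    ∑ b, (κM e b : ℂ) * (((lat L L' b).chordB (M b) (blockP L L' w b) (blockZ L L' u b) (blockP L L' u b) -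
          (lat L L' b).chordC (M b) (blockP L L' w b) (blockP L L' u b)) *
        ∏ b' ∈ Finset.univ.erase b, (lat L L' b').chordA (M b') (blockP L L' w b') (blockP L L' u b')) =
      ∑ J : γ ⊕ γ' → Fin 3, ∑ K : γ ⊕ γ' → Fin 3,
        (addCoeffS L L' κM M e J K u - u (is e) * addCoeffP L L' M J K u) *
          (thetaPnone (β := β) (δ := δ) L L' J w * thetaPnone (β := β) (δ := δ) L L' K w) := by
  simp only [rest_mul_prod_chordA, addCoeffS, add_sub_cancel_left, Finset.mul_sum, Finset.sum_mul]
  rw [Finset.sum_comm]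
  refine Finset.sum_congr rfl fun J _ => ?_
  rw [Finset.sum_comm]
  refine Finset.sum_congr rfl fun K _ => Finset.sum_congr rfl fun b _ => ?_
  ring

omit [Fintype β] [Fintype δ] in
/-- **The addition law for the fibre sections `Θ^P_{(M, some e)}`**:
`μ(w,u) Θ^P_{(M,some e)}(w + u) = ∑_{J,K} c_{M;J,K}(u) Θ^P_{(J,some e)}(w) Θ^P_{(K,none)}(w)
  + ∑_{J,K} d^e_{M;J,K}(u) Θ^P_{(J,none)}(w) Θ^P_{(K,none)}(w)` — linear in the fibre sections of
`w`, with the SAME coefficients `c` as the blocks. [folklore] -/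
theorem thetaPsome_add (M : γ ⊕ γ' → Fin 3) (e : δ) (w u : β ⊕ ((γ ⊕ γ') ⊕ δ) → ℂ) :
    addUnit (β := β) (δ := δ) L L' w u * thetaPsome (β := β) L L' κM M e (w + u) =
      ∑ J : γ ⊕ γ' → Fin 3, ∑ K : γ ⊕ γ' → Fin 3,
          addCoeffP L L' M J K u * (thetaPsome (β := β) L L' κM J e w * thetaPnone (β := β) (δ := δ) L L' K w) +
        ∑ J : γ ⊕ γ' → Fin 3, ∑ K : γ ⊕ γ' → Fin 3,
          addCoeffS L L' κM M e J K u * (thetaPnone (β := β) (δ := δ) L L' J w * thetaPnone (β := β) (δ := δ) L L' K w) := by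
  have h0 := thetaPnone_add (β := β) (δ := δ) L L' M w u
  have hb := fun b => addUnit_mul_companion_prod (β := β) (δ := δ) L L' M w u b
  have h5 := sum_chordB_mul_prod_chordA L L' κM M e w u
  have h6 := sum_rest_mul_prod_chordA L L' κM M e w u
  calc addUnit (β := β) (δ := δ) L L' w u * thetaPsome (β := β) L L' κM M e (w + u)
      = (w (is e) + u (is e)) * (addUnit (β := β) (δ := δ) L L' w u * thetaPnone (β := β) (δ := δ) L L' M (w + u)) -
          ∑ b, (κM e b : ℂ) * (addUnit (β := β) (δ := δ) L L' w u *
            ((lat L L' b).univExtZ (M b) ((w + u) (iz b)) *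
              ∏ b' ∈ Finset.univ.erase b, (lat L L' b').univExtP (M b') ((w + u) (iz b')))) := by
        unfold thetaPsome
        rw [Pi.add_apply, mul_sub, Finset.mul_sum]
        congr 1
        · ring
        · exact Finset.sum_congr rfl fun b _ => by ring
    _ = (w (is e) + u (is e)) * (∑ J : γ ⊕ γ' → Fin 3, ∑ K : γ ⊕ γ' → Fin 3,
            addCoeffP L L' M J K u * (thetaPnone (β := β) (δ := δ) L L' J w * thetaPnone (β := β) (δ := δ) L L' K w)) -
          (∑ b, (κM e b : ℂ) * ((lat L L' b).chordB (M b) (blockP L L' u b) (blockZ L L' w b) (blockP L L' w b) *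
              ∏ b' ∈ Finset.univ.erase b, (lat L L' b').chordA (M b') (blockP L L' w b') (blockP L L' u b')) -
            ∑ b, (κM e b : ℂ) * (((lat L L' b).chordB (M b) (blockP L L' w b) (blockZ L L' u b) (blockP L L' u b) -
                (lat L L' b).chordC (M b) (blockP L L' w b) (blockP L L' u b)) *
              ∏ b' ∈ Finset.univ.erase b, (lat L L' b').chordA (M b') (blockP L L' w b') (blockP L L' u b'))) := by
        rw [h0, ← Finset.sum_sub_distrib]
        congr 1
        exact Finset.sum_congr rfl fun b _ => by rw [hb b]; ring
    _ = _ := by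
        rw [h5, h6]
        simp only [Finset.mul_sum, ← Finset.sum_sub_distrib, ← Finset.sum_add_distrib]
        refine Finset.sum_congr rfl fun J _ => Finset.sum_congr rfl fun K _ => ?_
        unfold thetaPsome
        ring

/-! ### The law on the theta functions of `M_κ` -/

omit [Fintype β] [Fintype δ] in
/-- **The addition law of the theta model of `M_κ`, block coordinates**: for all `w, u ∈ Lie M_κ,ℂ`,
`μ(w, u) Θ_{(a,(M,none))}(w + u) = ∑_{J,K} T_a(u) c_{M;J,K}(u) · Θ_{(a,(J,none))}(w) Θ_{(none,(K,none))}(w)`: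
a form of degree `2` in `Θ(w)` whose coefficients are entire functions of `u`, with the unit
`μ(w, u) = ∏_b (-σ(z'_b - t'_b)³)` (non-zero off the block diagonals). [folklore] -/
theorem theta_add_none (a : Option β) (M : γ ⊕ γ' → Fin 3) (w u : β ⊕ ((γ ⊕ γ') ⊕ δ) → ℂ) :
    addUnit (β := β) (δ := δ) L L' w u * theta L L' κM (a, (M, none)) (w + u) =
      ∑ J : γ ⊕ γ' → Fin 3, ∑ K : γ ⊕ γ' → Fin 3, (thetaT (γ := γ ⊕ γ') (δ := δ) a u * addCoeffP L L' M J K u) *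
        (theta L L' κM (a, (J, none)) w * theta L L' κM (none, (K, none)) w) := by
  simp only [theta, thetaP_none, thetaT_none, one_mul, thetaT_add]
  rw [mul_left_comm, thetaPnone_add, Finset.mul_sum]
  refine Finset.sum_congr rfl fun J _ => ?_
  rw [Finset.mul_sum]
  refine Finset.sum_congr rfl fun K _ => ?_
  ring

omit [Fintype β] [Fintype δ] in
/-- **The addition law of the theta model of `M_κ`, fibre coordinates**: for all `w, u`,
`μ(w, u) Θ_{(a,(M,some e))}(w + u) = ∑_{J,K} T_a(u) c_{M;J,K}(u) · Θ_{(a,(J,some e))}(w) Θ_{(none,(K,none))}(w)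
  + ∑_{J,K} T_a(u) d^e_{M;J,K}(u) · Θ_{(a,(J,none))}(w) Θ_{(none,(K,none))}(w)`. [folklore] -/
theorem theta_add_some (a : Option β) (M : γ ⊕ γ' → Fin 3) (e : δ) (w u : β ⊕ ((γ ⊕ γ') ⊕ δ) → ℂ) :
    addUnit (β := β) (δ := δ) L L' w u * theta L L' κM (a, (M, some e)) (w + u) =
      ∑ J : γ ⊕ γ' → Fin 3, ∑ K : γ ⊕ γ' → Fin 3, (thetaT (γ := γ ⊕ γ') (δ := δ) a u * addCoeffP L L' M J K u) *
          (theta L L' κM (a, (J, some e)) w * theta L L' κM (none, (K, none)) w) +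
        ∑ J : γ ⊕ γ' → Fin 3, ∑ K : γ ⊕ γ' → Fin 3, (thetaT (γ := γ ⊕ γ') (δ := δ) a u * addCoeffS L L' κM M e J K u) *
          (theta L L' κM (a, (J, none)) w * theta L L' κM (none, (K, none)) w) := by
  simp only [theta, thetaP_some, thetaP_none, thetaT_none, one_mul, thetaT_add]
  rw [mul_left_comm, thetaPsome_add, mul_add, Finset.mul_sum, Finset.mul_sum]
  congr 1
  · refine Finset.sum_congr rfl fun J _ => ?_
    rw [Finset.mul_sum]
    refine Finset.sum_congr rfl fun K _ => ?_
    ring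
  · refine Finset.sum_congr rfl fun J _ => ?_
    rw [Finset.mul_sum]
    refine Finset.sum_congr rfl fun K _ => ?_
    ring

/-! ### Holomorphy of the unit and of the coefficients -/

/-- The unit `μ(w, u)` is an entire function of `(w, u)`. [folklore] -/
theorem differentiable_addUnit :
    Differentiable ℂ fun p : (β ⊕ ((γ ⊕ γ') ⊕ δ) → ℂ) × (β ⊕ ((γ ⊕ γ') ⊕ δ) → ℂ) =>
      addUnit (β := β) (δ := δ) L L' p.1 p.2 := by
  unfold addUnit
  refine differentiable_finset_prod
    (g := fun b (p : (β ⊕ ((γ ⊕ γ') ⊕ δ) → ℂ) × (β ⊕ ((γ ⊕ γ') ⊕ δ) → ℂ)) =>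
      -((lat L L' b).weierstrassSigma (p.1 (iz b) - p.2 (iz b)) ^ 3)) Finset.univ fun b _ => ?_
  have hσ := (lat L L' b).differentiable_weierstrassSigma_holds
  have hl : Differentiable ℂ fun p : (β ⊕ ((γ ⊕ γ') ⊕ δ) → ℂ) × (β ⊕ ((γ ⊕ γ') ⊕ δ) → ℂ) =>
      p.1 (iz b) - p.2 (iz b) := by
    fun_prop
  exact ((hσ.comp hl).pow 3).neg

omit [DecidableEq γ] [DecidableEq γ'] in
/-- The coefficient forms of the chord law along a block are entire in `u`. [folklore] -/
theorem differentiable_chordCoeff_blockP (i j k : Fin 3) (b : γ ⊕ γ') :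
    Differentiable ℂ fun u : β ⊕ ((γ ⊕ γ') ⊕ δ) → ℂ => (lat L L' b).chordCoeff i j k (blockP L L' u b) := by
  have h : (fun u : β ⊕ ((γ ⊕ γ') ⊕ δ) → ℂ => (lat L L' b).chordCoeff i j k (blockP L L' u b)) =
      fun u => ∑ l : Fin 3, ∑ m : Fin 3,
        (lat L L' b).chordCoeff₂ i j k l m * ((lat L L' b).univExtP l (u (iz b)) * (lat L L' b).univExtP m (u (iz b))) := by
    funext u; rw [(lat L L' b).chordCoeff_eq_sum]; rfl
  have h0 := differentiable_univExtP_comp (β := β) (δ := δ) L L' 0 b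
  have h1 := differentiable_univExtP_comp (β := β) (δ := δ) L L' 1 b
  have h2 := differentiable_univExtP_comp (β := β) (δ := δ) L L' 2 b
  rw [h]
  simp only [Fin.sum_univ_three]
  fun_prop

omit [DecidableEq γ] [DecidableEq γ'] in
/-- The `x`-coefficient forms of the correction along a block are entire in `u`. [folklore] -/
theorem differentiable_chordCcoeff_blockP (i l m : Fin 3) (b : γ ⊕ γ') :
    Differentiable ℂ fun u : β ⊕ ((γ ⊕ γ') ⊕ δ) → ℂ => (lat L L' b).chordCcoeff i l m (blockP L L' u b) := by
  have h0 := differentiable_univExtP_comp (β := β) (δ := δ) L L' 0 b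
  have h1 := differentiable_univExtP_comp (β := β) (δ := δ) L L' 1 b
  have h2 := differentiable_univExtP_comp (β := β) (δ := δ) L L' 2 b
  unfold PeriodPair.chordCcoeff
  simp only [Fin.sum_univ_three, blockP_apply]
  fun_prop

omit [DecidableEq γ] [DecidableEq γ'] in
/-- The bilinear companion expressions along a block are entire in `u`. [folklore] -/
theorem differentiable_companion_blockZP (i l m : Fin 3) (b : γ ⊕ γ') :
    Differentiable ℂ fun u : β ⊕ ((γ ⊕ γ') ⊕ δ) → ℂ =>
      ∑ j : Fin 3, ∑ k : Fin 3, (lat L L' b).chordCoeff₂ i j k l m * (blockZ L L' u b j * blockP L L' u b k) := by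
  have h0 := differentiable_univExtP_comp (β := β) (δ := δ) L L' 0 b
  have h1 := differentiable_univExtP_comp (β := β) (δ := δ) L L' 1 b
  have h2 := differentiable_univExtP_comp (β := β) (δ := δ) L L' 2 b
  have z0 := differentiable_univExtZ_comp (β := β) (δ := δ) L L' 0 b
  have z1 := differentiable_univExtZ_comp (β := β) (δ := δ) L L' 1 b
  have z2 := differentiable_univExtZ_comp (β := β) (δ := δ) L L' 2 b
  simp only [Fin.sum_univ_three, blockP_apply, blockZ_apply]
  fun_prop

/-- **The coefficients `c_{M;J,K}(u)` are entire.** [folklore] -/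
theorem differentiable_addCoeffP (M J K : γ ⊕ γ' → Fin 3) :
    Differentiable ℂ fun u : β ⊕ ((γ ⊕ γ') ⊕ δ) → ℂ => addCoeffP L L' M J K u := by
  unfold addCoeffP
  exact differentiable_finset_prod
    (g := fun b (u : β ⊕ ((γ ⊕ γ') ⊕ δ) → ℂ) => (lat L L' b).chordCoeff (M b) (J b) (K b) (blockP L L' u b))
    Finset.univ fun b _ => differentiable_chordCoeff_blockP L L' (M b) (J b) (K b) b

/-- **The coefficients `d^e_{M;J,K}(u)` are entire.** [folklore] -/
theorem differentiable_addCoeffS (M : γ ⊕ γ' → Fin 3) (e : δ) (J K : γ ⊕ γ' → Fin 3) :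
    Differentiable ℂ fun u : β ⊕ ((γ ⊕ γ') ⊕ δ) → ℂ => addCoeffS L L' κM M e J K u := by
  have hc := differentiable_addCoeffP (β := β) (δ := δ) L L' M J K
  have hs : Differentiable ℂ fun u : β ⊕ ((γ ⊕ γ') ⊕ δ) → ℂ => u (is e) := differentiable_apply (𝕜 := ℂ) (is e)
  have hsum : Differentiable ℂ fun u : β ⊕ ((γ ⊕ γ') ⊕ δ) → ℂ => ∑ b, (κM e b : ℂ) *
      (((∑ j : Fin 3, ∑ k : Fin 3,
          (lat L L' b).chordCoeff₂ (M b) j k (J b) (K b) * (blockZ L L' u b j * blockP L L' u b k)) -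
        (lat L L' b).chordCcoeff (M b) (J b) (K b) (blockP L L' u b)) *
      ∏ b' ∈ Finset.univ.erase b, (lat L L' b').chordCoeff (M b') (J b') (K b') (blockP L L' u b')) := by
    refine Differentiable.fun_sum
      (A := fun b (u : β ⊕ ((γ ⊕ γ') ⊕ δ) → ℂ) => (κM e b : ℂ) *
        (((∑ j : Fin 3, ∑ k : Fin 3,
            (lat L L' b).chordCoeff₂ (M b) j k (J b) (K b) * (blockZ L L' u b j * blockP L L' u b k)) -
          (lat L L' b).chordCcoeff (M b) (J b) (K b) (blockP L L' u b)) *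
        ∏ b' ∈ Finset.univ.erase b, (lat L L' b').chordCoeff (M b') (J b') (K b') (blockP L L' u b')))
      fun b _ => ?_
    have hpr : Differentiable ℂ fun u : β ⊕ ((γ ⊕ γ') ⊕ δ) → ℂ =>
        ∏ b' ∈ Finset.univ.erase b, (lat L L' b').chordCoeff (M b') (J b') (K b') (blockP L L' u b') :=
      differentiable_finset_prod
        (g := fun b' (u : β ⊕ ((γ ⊕ γ') ⊕ δ) → ℂ) => (lat L L' b').chordCoeff (M b') (J b') (K b') (blockP L L' u b'))
        (Finset.univ.erase b) fun b' _ => differentiable_chordCoeff_blockP L L' (M b') (J b') (K b') b'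
    exact (differentiable_const _).mul
      (((differentiable_companion_blockZP L L' (M b) (J b) (K b) b).sub
        (differentiable_chordCcoeff_blockP L L' (M b) (J b) (K b) b)).mul hpr)
  unfold addCoeffS
  exact (hs.mul hc).add hsum

/-! ### Good auxiliary points exist -/

omit [Fintype β] [Fintype γ] [Fintype γ'] [Fintype δ] [DecidableEq γ] [DecidableEq γ'] in
/-- A period lattice is countable. [folklore] -/
theorem lattice_countable (Λ : PeriodPair) : (Λ.lattice : Set ℂ).Countable := by
  have : (Λ.lattice : Set ℂ) ⊆
      Set.range (fun p : ℤ × ℤ => (p.1 : ℂ) * Λ.ω₁ + (p.2 : ℂ) * Λ.ω₂) := by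
    intro x hx
    obtain ⟨m, n, h⟩ := PeriodPair.mem_lattice.mp hx
    exact ⟨(m, n), h⟩
  exact (Set.countable_range _).mono this

omit [Fintype β] [Fintype γ] [Fintype γ'] [Fintype δ] [DecidableEq γ] [DecidableEq γ'] in
/-- For any two points `a, σ` there is an auxiliary `s` off all the relevant block diagonals:
`a_b + s_b ∉ Λ` and `a_b - σ_b - 2 s_b ∉ Λ` for all `b` (countably many excluded values per
block) — so that the units `μ(w, -s)` at `w = a` and `μ(w - s, z + s)` at `(a, σ)` are non-zero
(composition of two laws through the intermediate point `a - s`). [folklore] -/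
theorem exists_aux_point (a σ : β ⊕ ((γ ⊕ γ') ⊕ δ) → ℂ) :
    ∃ s : β ⊕ ((γ ⊕ γ') ⊕ δ) → ℂ, (∀ b, a (iz b) + s (iz b) ∉ (lat L L' b).lattice) ∧
      ∀ b, a (iz b) - σ (iz b) - 2 * s (iz b) ∉ (lat L L' b).lattice := by
  -- blockwise choice off a countable set, by density of its complement
  have hb : ∀ b : γ ⊕ γ', ∃ c : ℂ, a (iz b) + c ∉ (lat L L' b).lattice ∧ a (iz b) - σ (iz b) - 2 * c ∉ (lat L L' b).lattice := by
    intro b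
    have hΛ := lattice_countable (lat L L' b)
    have hc : ((fun l : ℂ => l - a (iz b)) '' ((lat L L' b).lattice : Set ℂ) ∪
        (fun l : ℂ => (a (iz b) - σ (iz b) - l) / 2) '' ((lat L L' b).lattice : Set ℂ)).Countable :=
      (hΛ.image _).union (hΛ.image _)
    obtain ⟨c, hc⟩ := (hc.dense_compl ℂ).nonempty
    simp only [Set.mem_compl_iff, Set.mem_union, Set.mem_image, SetLike.mem_coe, not_or,
      not_exists, not_and] at hc
    refine ⟨c, fun h => hc.1 _ h (by ring), fun h => hc.2 _ h (by ring)⟩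
  choose c hc using hb
  refine ⟨fun i => Sum.elim (fun _ => 0) (Sum.elim c fun _ => 0) i, fun b => ?_, fun b => ?_⟩
  · simpa [iz] using (hc b).1
  · simpa [iz] using (hc b).2

/-! ## The law as polynomials (port of `PkappaThetaAdditionPoly.lean`) -/

/-! ### The law as quadratic polynomials in the theta coordinates -/

/-- **The addition law of the theta model as polynomials**: for `u ∈ Lie M_κ,ℂ` and a theta index
`J`, the quadratic form `Q_J^{(u)} ∈ ℂ[X]₂` with `Q_J^{(u)}(Θ(w)) = μ(w, u) Θ_J(w + u)`
(`thetaEval_addPoly`); coefficients from `PkappaThetaAddition.lean`. [folklore] -/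
def addPoly (u : β ⊕ ((γ ⊕ γ') ⊕ δ) → ℂ) :
    Option β × ThetaIdx (γ ⊕ γ') δ → MvPolynomial (Option β × ThetaIdx (γ ⊕ γ') δ) ℂ
  | (a, (M, none)) => ∑ J : γ ⊕ γ' → Fin 3, ∑ K : γ ⊕ γ' → Fin 3,
      C (thetaT (γ := γ ⊕ γ') (δ := δ) a u * addCoeffP L L' M J K u) *
        (X (a, (J, none)) * X (none, (K, none)))
  | (a, (M, some e)) => ∑ J : γ ⊕ γ' → Fin 3, ∑ K : γ ⊕ γ' → Fin 3,
      C (thetaT (γ := γ ⊕ γ') (δ := δ) a u * addCoeffP L L' M J K u) *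
        (X (a, (J, some e)) * X (none, (K, none))) +
      ∑ J : γ ⊕ γ' → Fin 3, ∑ K : γ ⊕ γ' → Fin 3,
        C (thetaT (γ := γ ⊕ γ') (δ := δ) a u * addCoeffS L L' κM M e J K u) *
          (X (a, (J, none)) * X (none, (K, none)))

omit [Fintype β] [Fintype δ] in
/-- The law is a quadratic form. [folklore] -/
theorem addPoly_isHomogeneous (u : β ⊕ ((γ ⊕ γ') ⊕ δ) → ℂ) (J : Option β × ThetaIdx (γ ⊕ γ') δ) :
    (addPoly L L' κM u J).IsHomogeneous 2 := by
  have hXX : ∀ J₁ J₂ : Option β × ThetaIdx (γ ⊕ γ') δ, ∀ c : ℂ,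
      (C c * (X J₁ * X J₂) : MvPolynomial (Option β × ThetaIdx (γ ⊕ γ') δ) ℂ).IsHomogeneous 2 := by
    intro J₁ J₂ c
    simpa using ((isHomogeneous_X ℂ J₁).mul (isHomogeneous_X ℂ J₂)).C_mul c
  obtain ⟨a, M, _ | e⟩ := J
  · exact IsHomogeneous.sum _ _ _ fun J _ => IsHomogeneous.sum _ _ _ fun K _ => hXX _ _ _
  · exact (IsHomogeneous.sum _ _ _ fun J _ => IsHomogeneous.sum _ _ _ fun K _ => hXX _ _ _).add
      (IsHomogeneous.sum _ _ _ fun J _ => IsHomogeneous.sum _ _ _ fun K _ => hXX _ _ _)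

omit [Fintype β] [Fintype δ] in
/-- **`Q_J^{(u)}(Θ(w)) = μ(w, u) Θ_J(w + u)`** for all `w, u`. [folklore] -/
theorem thetaEval_addPoly (u : β ⊕ ((γ ⊕ γ') ⊕ δ) → ℂ) (J : Option β × ThetaIdx (γ ⊕ γ') δ)
    (w : β ⊕ ((γ ⊕ γ') ⊕ δ) → ℂ) :
    thetaEval L L' κM (addPoly L L' κM u J) w = addUnit (β := β) (δ := δ) L L' w u * theta L L' κM J (w + u) := by
  obtain ⟨a, M, _ | e⟩ := J
  · rw [theta_add_none]
    simp [addPoly, thetaEval, map_sum, map_mul, eval_C, eval_X]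
  · rw [theta_add_some]
    simp [addPoly, thetaEval, map_sum, map_mul, map_add, eval_C, eval_X]

/-- The coefficients of the law are entire functions of `u`. [folklore] -/
theorem coeffDifferentiable_addPoly (J : Option β × ThetaIdx (γ ⊕ γ') δ) :
    CoeffDifferentiable fun u : β ⊕ ((γ ⊕ γ') ⊕ δ) → ℂ => addPoly L L' κM u J := by
  have hT : ∀ a : Option β, Differentiable ℂ fun u : β ⊕ ((γ ⊕ γ') ⊕ δ) → ℂ => thetaT (γ := γ ⊕ γ') (δ := δ) a u :=
    fun a => differentiable_thetaT a
  obtain ⟨a, M, _ | e⟩ := J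
  · simp only [addPoly]
    refine CoeffDifferentiable.sum _ fun J _ => CoeffDifferentiable.sum _ fun K _ => ?_
    exact (coeffDifferentiable_C ((hT a).mul (differentiable_addCoeffP L L' M J K))).mul
      (coeffDifferentiable_const _)
  · simp only [addPoly]
    refine (CoeffDifferentiable.sum _ fun J _ => CoeffDifferentiable.sum _ fun K _ => ?_).add
      (CoeffDifferentiable.sum _ fun J _ => CoeffDifferentiable.sum _ fun K _ => ?_)
    · exact (coeffDifferentiable_C ((hT a).mul (differentiable_addCoeffP L L' M J K))).mul
        (coeffDifferentiable_const _)
    · exact (coeffDifferentiable_C ((hT a).mul (differentiable_addCoeffS L L' κM M e J K))).mul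
        (coeffDifferentiable_const _)

/-! ### Translation of forms -/

/-- **Translation of a form by `u`**: `P ↦ P^{(u)} = P(Q^{(u)})` (substitution of the law), so
that `P^{(u)}(Θ(w)) = μ(w, u)^D P(Θ(w + u))` for `P` of degree `D` (`thetaEval_translate`).
[cite: NesterenkoPhilippon2001, Ch. 11 Prop. 3.6 (iv) (the set F of polynomials P(A(X, ψ_σ(z))))] -/
def translate (u : β ⊕ ((γ ⊕ γ') ⊕ δ) → ℂ) (P : MvPolynomial (Option β × ThetaIdx (γ ⊕ γ') δ) ℂ) :
    MvPolynomial (Option β × ThetaIdx (γ ⊕ γ') δ) ℂ :=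
  bind₁ (addPoly L L' κM u) P

omit [Fintype β] [Fintype δ] in
/-- The translate of a form of degree `D` is a form of degree `2D`. [folklore] -/
theorem translate_isHomogeneous (u : β ⊕ ((γ ⊕ γ') ⊕ δ) → ℂ) {P : MvPolynomial (Option β × ThetaIdx (γ ⊕ γ') δ) ℂ}
    {D : ℕ} (hP : P.IsHomogeneous D) : (translate L L' κM u P).IsHomogeneous (2 * D) := by
  rw [translate, ← aeval_eq_bind₁]
  exact hP.aeval _ (addPoly_isHomogeneous L L' κM u)

omit [Fintype β] [Fintype δ] in
/-- **`P^{(u)}(Θ(w)) = μ(w, u)^D · P(Θ(w + u))`** for `P` homogeneous of degree `D` and all `w, u`.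
[folklore] -/
theorem thetaEval_translate (u : β ⊕ ((γ ⊕ γ') ⊕ δ) → ℂ) {P : MvPolynomial (Option β × ThetaIdx (γ ⊕ γ') δ) ℂ}
    {D : ℕ} (hP : P.IsHomogeneous D) (w : β ⊕ ((γ ⊕ γ') ⊕ δ) → ℂ) :
    thetaEval L L' κM (translate L L' κM u P) w =
      addUnit (β := β) (δ := δ) L L' w u ^ D * thetaEval L L' κM P (w + u) := by
  unfold thetaEval translate
  rw [eval_bind₁]
  have h : (fun J => eval (fun J' => theta L L' κM J' w) (addPoly L L' κM u J)) =
      addUnit (β := β) (δ := δ) L L' w u • fun J => theta L L' κM J (w + u) := by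
    funext J
    exact thetaEval_addPoly L L' κM u J w
  rw [h, eval_smul_of_isHomogeneous hP]

/-- The coefficients of the translates of a fixed form are entire functions of `u`. [folklore] -/
theorem coeffDifferentiable_translate (P : MvPolynomial (Option β × ThetaIdx (γ ⊕ γ') δ) ℂ) :
    CoeffDifferentiable fun u : β ⊕ ((γ ⊕ γ') ⊕ δ) → ℂ => translate L L' κM u P :=
  coeffDifferentiable_bind₁ (coeffDifferentiable_addPoly L L' κM) P

/-! ### Composition through an auxiliary point: the analytic addition law at every point -/

/-- **The composed law** through the auxiliary point `s`: the quartic forms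
`R_J^{(s; z)} = (Q_J^{(z + s)})^{(-s)} ∈ ℂ[X]₄` expressing `Θ_J(w + z)` through `Θ(w)` via the
intermediate point `w - s`. [folklore] -/
def lawPoly (s z : β ⊕ ((γ ⊕ γ') ⊕ δ) → ℂ) (J : Option β × ThetaIdx (γ ⊕ γ') δ) :
    MvPolynomial (Option β × ThetaIdx (γ ⊕ γ') δ) ℂ :=
  translate L L' κM (-s) (addPoly L L' κM (z + s) J)

/-- **The unit of the composed law**: `U_s(w, z) = μ(w, -s)² μ(w - s, z + s)`. [folklore] -/
def lawUnit (s w z : β ⊕ ((γ ⊕ γ') ⊕ δ) → ℂ) : ℂ :=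
  addUnit (β := β) (δ := δ) L L' w (-s) ^ 2 * addUnit (β := β) (δ := δ) L L' (w - s) (z + s)

omit [Fintype β] [Fintype δ] in
/-- The composed law is a quartic form. [folklore] -/
theorem lawPoly_isHomogeneous (s z : β ⊕ ((γ ⊕ γ') ⊕ δ) → ℂ) (J : Option β × ThetaIdx (γ ⊕ γ') δ) :
    (lawPoly L L' κM s z J).IsHomogeneous 4 := by
  unfold lawPoly
  simpa using translate_isHomogeneous L L' κM (-s) (addPoly_isHomogeneous L L' κM (z + s) J)

omit [Fintype β] [Fintype δ] in
/-- **`R_J^{(s;z)}(Θ(w)) = U_s(w, z) · Θ_J(w + z)`** for ALL `w, z` (and every auxiliary `s`).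
[folklore] -/
theorem thetaEval_lawPoly (s z : β ⊕ ((γ ⊕ γ') ⊕ δ) → ℂ) (J : Option β × ThetaIdx (γ ⊕ γ') δ)
    (w : β ⊕ ((γ ⊕ γ') ⊕ δ) → ℂ) :
    thetaEval L L' κM (lawPoly L L' κM s z J) w = lawUnit (β := β) (δ := δ) L L' s w z * theta L L' κM J (w + z) := by
  rw [lawPoly, thetaEval_translate L L' κM (-s) (addPoly_isHomogeneous L L' κM (z + s) J), thetaEval_addPoly,
    lawUnit, ← sub_eq_add_neg, show w - s + (z + s) = w + z by abel]
  ring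

omit [Fintype β] [Fintype δ] [DecidableEq γ] [DecidableEq γ'] in
/-- **Where the composed law is good**: `U_s(w, z) ≠ 0` iff `z'_b(w) + z'_b(s) ∉ Λ` and
`z'_b(w) - z'_b(s) - (z'_b(z) + z'_b(s)) ∉ Λ` for all blocks `b`. [folklore] -/
theorem lawUnit_ne_zero_iff (s w z : β ⊕ ((γ ⊕ γ') ⊕ δ) → ℂ) :
    lawUnit (β := β) (δ := δ) L L' s w z ≠ 0 ↔
      (∀ b, w (iz b) + s (iz b) ∉ (lat L L' b).lattice) ∧
        ∀ b, w (iz b) - s (iz b) - (z (iz b) + s (iz b)) ∉ (lat L L' b).lattice := by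
  rw [lawUnit, mul_ne_zero_iff, pow_ne_zero_iff two_ne_zero, addUnit_ne_zero_iff,
    addUnit_ne_zero_iff]
  simp only [Pi.neg_apply, sub_neg_eq_add, Pi.sub_apply, Pi.add_apply]

omit [Fintype β] [Fintype δ] [DecidableEq γ] [DecidableEq γ'] in
/-- **Completeness: at every pair of points some composed law is good.** For all
`a, σ ∈ Lie M_κ,ℂ` there is an auxiliary `s` with `U_s(a, σ) ≠ 0` (then `U_s ≠ 0` near `(a, σ)` by
continuity). This replaces a complete system of addition laws (Roy, LNM 1752, Ch. 11, §2.1) for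
the theta model of `M_κ`. [folklore] -/
theorem exists_lawUnit_ne_zero (a σ : β ⊕ ((γ ⊕ γ') ⊕ δ) → ℂ) :
    ∃ s : β ⊕ ((γ ⊕ γ') ⊕ δ) → ℂ, lawUnit (β := β) (δ := δ) L L' s a σ ≠ 0 := by
  obtain ⟨s, h1, h2⟩ := exists_aux_point (β := β) (δ := δ) L L' a σ
  refine ⟨s, (lawUnit_ne_zero_iff L L' s a σ).mpr ⟨h1, fun b => ?_⟩⟩
  have := h2 b
  rwa [show a (iz b) - s (iz b) - (σ (iz b) + s (iz b)) = a (iz b) - σ (iz b) - 2 * s (iz b) by ring]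

/-- The unit of the composed law is an entire function of `(w, z)`. [folklore] -/
theorem differentiable_lawUnit (s : β ⊕ ((γ ⊕ γ') ⊕ δ) → ℂ) :
    Differentiable ℂ fun p : (β ⊕ ((γ ⊕ γ') ⊕ δ) → ℂ) × (β ⊕ ((γ ⊕ γ') ⊕ δ) → ℂ) =>
      lawUnit (β := β) (δ := δ) L L' s p.1 p.2 := by
  have hμ := differentiable_addUnit (β := β) (γ := γ) (γ' := γ') (δ := δ) L L'
  have h1 : Differentiable ℂ fun p : (β ⊕ ((γ ⊕ γ') ⊕ δ) → ℂ) × (β ⊕ ((γ ⊕ γ') ⊕ δ) → ℂ) =>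
      addUnit (β := β) (δ := δ) L L' p.1 (-s) :=
    hμ.comp (f := fun p : (β ⊕ ((γ ⊕ γ') ⊕ δ) → ℂ) × (β ⊕ ((γ ⊕ γ') ⊕ δ) → ℂ) => (p.1, -s)) (by fun_prop)
  have h2 : Differentiable ℂ fun p : (β ⊕ ((γ ⊕ γ') ⊕ δ) → ℂ) × (β ⊕ ((γ ⊕ γ') ⊕ δ) → ℂ) =>
      addUnit (β := β) (δ := δ) L L' (p.1 - s) (p.2 + s) :=
    hμ.comp (f := fun p : (β ⊕ ((γ ⊕ γ') ⊕ δ) → ℂ) × (β ⊕ ((γ ⊕ γ') ⊕ δ) → ℂ) => (p.1 - s, p.2 + s))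
      (by fun_prop)
  unfold lawUnit
  exact (h1.pow 2).mul h2

/-- The unit of the composed law is continuous; in particular it stays non-zero near a good pair.
[folklore] -/
theorem continuous_lawUnit (s : β ⊕ ((γ ⊕ γ') ⊕ δ) → ℂ) :
    Continuous fun p : (β ⊕ ((γ ⊕ γ') ⊕ δ) → ℂ) × (β ⊕ ((γ ⊕ γ') ⊕ δ) → ℂ) =>
      lawUnit (β := β) (δ := δ) L L' s p.1 p.2 :=
  (differentiable_lawUnit L L' s).continuous

/-- The coefficients of the composed law are entire functions of the translation parameter `z`
(for fixed auxiliary `s`). [folklore] -/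
theorem coeffDifferentiable_lawPoly (s : β ⊕ ((γ ⊕ γ') ⊕ δ) → ℂ) (J : Option β × ThetaIdx (γ ⊕ γ') δ) :
    CoeffDifferentiable fun z : β ⊕ ((γ ⊕ γ') ⊕ δ) → ℂ => lawPoly L L' κM s z J := by
  classical
  -- `z ↦ bind₁ (addPoly (-s)) (addPoly (z + s) J)`: a FIXED substitution applied to a holomorphic
  -- family of quadratic forms — the coefficients depend linearly on those of the family
  have h : CoeffDifferentiable fun z : β ⊕ ((γ ⊕ γ') ⊕ δ) → ℂ => addPoly L L' κM (z + s) J := by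
    intro m
    exact ((coeffDifferentiable_addPoly L L' κM J) m).comp (differentiable_id.add_const s)
  have heq : (fun z : β ⊕ ((γ ⊕ γ') ⊕ δ) → ℂ => MvPolynomial.bind₁ (addPoly L L' κM (-s)) (addPoly L L' κM (z + s) J)) =
      fun z => ∑ d ∈ (Finset.finsuppAntidiag (Finset.univ : Finset (Option β × ThetaIdx (γ ⊕ γ') δ)) 2),
        C (coeff d (addPoly L L' κM (z + s) J)) * ∏ i ∈ d.support, addPoly L L' κM (-s) i ^ d i := by
    funext z
    rw [← aeval_eq_bind₁, aeval_def, eval₂_eq]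
    refine Finset.sum_subset (fun d hd => ?_) fun d _ hd => by
      rw [notMem_support_iff.mp hd, map_zero, zero_mul]
    rw [Finset.mem_finsuppAntidiag]
    refine ⟨?_, fun i _ => Finset.mem_univ i⟩
    have hh := addPoly_isHomogeneous L L' κM (z + s) J (mem_support_iff.mp hd)
    rw [← Finset.sum_subset (Finset.subset_univ d.support)
      (fun i _ hi => Finsupp.notMem_support_iff.mp hi)]
    simpa [Finsupp.weight_apply, Finsupp.sum] using hh
  unfold lawPoly translate
  rw [heq]
  exact CoeffDifferentiable.sum _ fun d _ => (coeffDifferentiable_C (h d)).mul (coeffDifferentiable_const _)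

/-- **The analytic addition law at every point** (summary): for all `a, σ ∈ Lie M_κ,ℂ` there are an
auxiliary `s`, an entire unit `U = U_s` with `U(a, σ) ≠ 0`, and quartic forms `R_J^{(z)}` whose
coefficients are entire in `z`, with `R_J^{(z)}(Θ(w)) = U(w, z) Θ_J(w + z)` for ALL `w, z, J`.
[cite: NesterenkoPhilippon2001, Ch. 11 §2.1 (complete systems of addition laws; c(G)) and Prop. 3.6 (iv)] -/
theorem exists_analytic_addition_law (a σ : β ⊕ ((γ ⊕ γ') ⊕ δ) → ℂ) :
    ∃ s : β ⊕ ((γ ⊕ γ') ⊕ δ) → ℂ, lawUnit (β := β) (δ := δ) L L' s a σ ≠ 0 ∧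
      (∀ z J, (lawPoly L L' κM s z J).IsHomogeneous 4) ∧
      (∀ J, CoeffDifferentiable fun z : β ⊕ ((γ ⊕ γ') ⊕ δ) → ℂ => lawPoly L L' κM s z J) ∧
      (Differentiable ℂ fun p : (β ⊕ ((γ ⊕ γ') ⊕ δ) → ℂ) × (β ⊕ ((γ ⊕ γ') ⊕ δ) → ℂ) =>
        lawUnit (β := β) (δ := δ) L L' s p.1 p.2) ∧
      ∀ w z J, thetaEval L L' κM (lawPoly L L' κM s z J) w =
        lawUnit (β := β) (δ := δ) L L' s w z * theta L L' κM J (w + z) := by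
  obtain ⟨s, hs⟩ := exists_lawUnit_ne_zero (β := β) (δ := δ) L L' a σ
  exact ⟨s, hs, lawPoly_isHomogeneous L L' κM s, coeffDifferentiable_lawPoly L L' κM s,
    differentiable_lawUnit L L' s, fun w z J => thetaEval_lawPoly L L' κM s z J w⟩

/-! ## A finite complete family of analytic laws (port of `PkappaLawFamily.lean`) -/

/-! ### The auxiliary points -/

/-- The auxiliary points `s_α`: `(α + 1) τ` on every `E`-coordinate, `0` elsewhere, with
`τ = τ_{4|γ|+2}` the generic shift of the lattice of the block. [folklore] -/
def auxPt (α : ℕ) : β ⊕ ((γ ⊕ γ') ⊕ δ) → ℂ := fun i =>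
  match i with
  | Sum.inr (Sum.inl b) => ((α : ℂ) + 1) * genericShift (lat L L' b) (4 * Fintype.card (γ ⊕ γ') + 2)
  | _ => 0

omit [Fintype β] [Fintype δ] [DecidableEq γ] [DecidableEq γ'] in
/-- The `E`-coordinates of the auxiliary points. [folklore] -/
@[simp] theorem auxPt_iz (α : ℕ) (b : γ ⊕ γ') :
    auxPt (β := β) (δ := δ) L L' α (iz b) =
      ((α : ℂ) + 1) * genericShift (lat L L' b) (4 * Fintype.card (γ ⊕ γ') + 2) := rfl

omit [Fintype β] [Fintype δ] [DecidableEq γ] [DecidableEq γ'] in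
/-- Differences of the `E`-coordinates of distinct auxiliary points (and their doubles) are not
periods, for indices `< 2|γ| + 1`. [folklore] -/
theorem auxPt_sub_notMem {α α' : ℕ} (hα : α < 2 * Fintype.card (γ ⊕ γ') + 1) (hα' : α' < 2 * Fintype.card (γ ⊕ γ') + 1)
    (hne : α ≠ α') (b : γ ⊕ γ') (e : ℕ) (he : e = 1 ∨ e = 2) :
    (e : ℂ) * (auxPt (β := β) (δ := δ) L L' α (iz b) - auxPt (β := β) (δ := δ) L L' α' (iz b)) ∉ (lat L L' b).lattice := by
  rw [auxPt_iz, auxPt_iz, ← sub_mul, ← mul_assoc]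
  have : (e : ℂ) * ((α : ℂ) + 1 - ((α' : ℂ) + 1)) = ((e * ((α : ℤ) - α') : ℤ) : ℂ) := by push_cast; ring
  rw [this]
  refine intCast_mul_genericShift_notMem (lat L L' b) _ ?_ ?_
  · have h : (α : ℤ) - α' ≠ 0 := sub_ne_zero.mpr (by exact_mod_cast hne)
    rcases he with rfl | rfl
    · simpa using h
    · exact mul_ne_zero (by norm_num) h
  · have h : |(α : ℤ) - α'| ≤ 2 * Fintype.card (γ ⊕ γ') := by
      rw [abs_sub_le_iff]; constructor <;> omega
    rcases he with rfl | rfl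
    · rw [Nat.cast_one, one_mul]; push_cast; omega
    · rw [abs_mul, Nat.cast_ofNat, abs_two]; push_cast; omega

omit [Fintype β] [Fintype δ] [DecidableEq γ] [DecidableEq γ'] in
/-- **Completeness of the family**: for every `(u, v)` some `lawUnit L L' s_α u v ≠ 0`, `α ≤ 2|γ|`.
[cite: MasserWustholz1981, §2 (complete system of addition laws)] -/
theorem exists_lawUnit_auxPt_ne_zero (u v : β ⊕ ((γ ⊕ γ') ⊕ δ) → ℂ) :
    ∃ α : Fin (2 * Fintype.card (γ ⊕ γ') + 1), lawUnit (β := β) (δ := δ) L L' (auxPt L L' α) u v ≠ 0 := by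
  classical
  -- bad indices: for each `b`, at most one `α` with `u_b + s_{α,b} ∈ Λ`, at most one with
  -- `u_b - v_b - 2 s_{α,b} ∈ Λ`
  set n := Fintype.card (γ ⊕ γ') with hn
  let bad₁ : γ ⊕ γ' → Finset (Fin (2 * n + 1)) := fun b =>
    Finset.univ.filter fun α => u (iz b) + auxPt (β := β) (δ := δ) L L' α (iz b) ∈ (lat L L' b).lattice
  let bad₂ : γ ⊕ γ' → Finset (Fin (2 * n + 1)) := fun b =>
    Finset.univ.filter fun α => u (iz b) - auxPt (β := β) (δ := δ) L L' α (iz b) -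
      (v (iz b) + auxPt (β := β) (δ := δ) L L' α (iz b)) ∈ (lat L L' b).lattice
  have hcard₁ : ∀ b, (bad₁ b).card ≤ 1 := fun b => by
    refine Finset.card_le_one.mpr fun α hα α' hα' => ?_
    by_contra hne
    simp only [bad₁, Finset.mem_filter, Finset.mem_univ, true_and] at hα hα'
    have hsub := (lat L L' b).lattice.sub_mem hα hα'
    have : u (iz b) + auxPt (β := β) (δ := δ) L L' α (iz b) - (u (iz b) + auxPt (β := β) (δ := δ) L L' α' (iz b)) =
        (1 : ℕ) * (auxPt (β := β) (δ := δ) L L' α (iz b) - auxPt (β := β) (δ := δ) L L' α' (iz b)) := by push_cast; ring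
    rw [this] at hsub
    exact auxPt_sub_notMem L L' α.2 α'.2 (fun h => hne (Fin.ext h)) b 1 (Or.inl rfl) hsub
  have hcard₂ : ∀ b, (bad₂ b).card ≤ 1 := fun b => by
    refine Finset.card_le_one.mpr fun α hα α' hα' => ?_
    by_contra hne
    simp only [bad₂, Finset.mem_filter, Finset.mem_univ, true_and] at hα hα'
    have hsub := (lat L L' b).lattice.sub_mem hα' hα
    have : u (iz b) - auxPt (β := β) (δ := δ) L L' α' (iz b) - (v (iz b) + auxPt (β := β) (δ := δ) L L' α' (iz b)) -
        (u (iz b) - auxPt (β := β) (δ := δ) L L' α (iz b) - (v (iz b) + auxPt (β := β) (δ := δ) L L' α (iz b))) =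
        (2 : ℕ) * (auxPt (β := β) (δ := δ) L L' α (iz b) - auxPt (β := β) (δ := δ) L L' α' (iz b)) := by push_cast; ring
    rw [this] at hsub
    exact auxPt_sub_notMem L L' α.2 α'.2 (fun h => hne (Fin.ext h)) b 2 (Or.inr rfl) hsub
  -- the union of the bad sets has `≤ 2n < 2n + 1` elements
  set bad : Finset (Fin (2 * n + 1)) := Finset.univ.biUnion fun b => bad₁ b ∪ bad₂ b with hbad
  have hbadcard : bad.card ≤ 2 * n := by
    calc bad.card ≤ ∑ b, (bad₁ b ∪ bad₂ b).card := Finset.card_biUnion_le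
      _ ≤ ∑ _b : γ ⊕ γ', 2 := Finset.sum_le_sum fun b _ => (Finset.card_union_le _ _).trans (by have := hcard₁ b; have := hcard₂ b; omega)
      _ = 2 * n := by simp [hn, mul_comm]
  have hlt : bad.card < (Finset.univ : Finset (Fin (2 * n + 1))).card := by
    rw [Finset.card_univ, Fintype.card_fin]; omega
  obtain ⟨α, -, hα⟩ := Finset.exists_mem_notMem_of_card_lt_card hlt
  refine ⟨α, (lawUnit_ne_zero_iff L L' _ u v).mpr ⟨fun b hb => hα ?_, fun b hb => hα ?_⟩⟩
  · rw [hbad, Finset.mem_biUnion]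
    exact ⟨b, Finset.mem_univ b, Finset.mem_union_left _ (by simpa [bad₁] using hb)⟩
  · rw [hbad, Finset.mem_biUnion]
    exact ⟨b, Finset.mem_univ b, Finset.mem_union_right _ (by simpa [bad₂] using hb)⟩

/-! ## The bihomogeneous laws with constant coefficients (port of `PkappaThetaLaws.lean`) -/

/-! ### The constant tensors of the law -/

/-- **The block tensor** `A_{M;JK;PQ} = ∏_b a^{(M_b)}_{J_bK_b;P_bQ_b}`. [folklore] -/
def lawA (M J K P Q : γ ⊕ γ' → Fin 3) : ℂ :=
  ∏ b, (lat L L' b).chordCoeff₂ (M b) (J b) (K b) (P b) (Q b)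

/-- **The fibre tensor** `B^e_{M;JK;PQ} = -∑_b κ_{eb} c^{(M_b)}_{J_bK_b;P_bQ_b} ∏_{b'≠b} a^{(M_{b'})}_{J_{b'}K_{b'};P_{b'}Q_{b'}}`.
[folklore] -/
def lawB (M : γ ⊕ γ' → Fin 3) (e : δ) (J K P Q : γ ⊕ γ' → Fin 3) : ℂ :=
  -∑ b, (κM e b : ℂ) * ((lat L L' b).chordC₂ (M b) (J b) (K b) (P b) (Q b) *
    ∏ b' ∈ Finset.univ.erase b, (lat L L' b').chordCoeff₂ (M b') (J b') (K b') (P b') (Q b'))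

/-! ### The coefficients of the law as quadratic forms in `Θ(u)` -/

omit [Fintype β] [Fintype δ] in
/-- `c_{M;JK}(u) = ∑_{P,Q} A_{M;JK;PQ} Θ^P_{(P,none)}(u) Θ^P_{(Q,none)}(u)`. [folklore] -/
theorem addCoeffP_eq_sum (M J K : γ ⊕ γ' → Fin 3) (u : β ⊕ ((γ ⊕ γ') ⊕ δ) → ℂ) :
    addCoeffP L L' M J K u = ∑ P : γ ⊕ γ' → Fin 3, ∑ Q : γ ⊕ γ' → Fin 3,
      lawA L L' M J K P Q * (thetaPnone (β := β) (δ := δ) L L' P u * thetaPnone (β := β) (δ := δ) L L' Q u) := by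
  unfold addCoeffP lawA thetaPnone
  simp_rw [PeriodPair.chordCoeff_eq_sum]
  rw [prod_sum_sum_eq (fun b l m => (lat L L' b).chordCoeff₂ (M b) (J b) (K b) l m) (blockP L L' u) (blockP L L' u)]
  simp only [blockP_apply]

omit [Fintype β] [Fintype δ] in
/-- Segre expansion with one marked block carrying the vector `v` instead of `P(t'_b)`:
`∑_{P,Q} A_{M;JK;PQ} (v_{P_b} ∏_{b'≠b} P_{P_{b'}}) Θ^P_Q = (∑_{l,m} a^{(M_b)}_{J_bK_b;lm} v_l P_m(t'_b)) ∏_{b'≠b} α(P(t'_{b'}))`.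
[folklore] -/
theorem sum_lawA_marked (M J K : γ ⊕ γ' → Fin 3) (u : β ⊕ ((γ ⊕ γ') ⊕ δ) → ℂ) (b : γ ⊕ γ') (v : Fin 3 → ℂ) :
    ∑ P : γ ⊕ γ' → Fin 3, ∑ Q : γ ⊕ γ' → Fin 3, lawA L L' M J K P Q *
        ((v (P b) * ∏ b' ∈ Finset.univ.erase b, blockP L L' u b' (P b')) *
          thetaPnone (β := β) (δ := δ) L L' Q u) =
      (∑ l : Fin 3, ∑ m : Fin 3, (lat L L' b).chordCoeff₂ (M b) (J b) (K b) l m * (v l * blockP L L' u b m)) *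
        ∏ b' ∈ Finset.univ.erase b, (lat L L' b').chordCoeff (M b') (J b') (K b') (blockP L L' u b') := by
  have h := prod_sum_sum_eq (fun b' l m => (lat L L' b').chordCoeff₂ (M b') (J b') (K b') l m)
    (Function.update (blockP L L' u) b v) (blockP L L' u)
  rw [← Finset.mul_prod_erase _ _ (Finset.mem_univ b), Function.update_self] at h
  have hl : ∏ b' ∈ Finset.univ.erase b, ∑ l : Fin 3, ∑ m : Fin 3,
      (lat L L' b').chordCoeff₂ (M b') (J b') (K b') l m * (Function.update (blockP L L' u) b v b' l * blockP L L' u b' m) =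
      ∏ b' ∈ Finset.univ.erase b, (lat L L' b').chordCoeff (M b') (J b') (K b') (blockP L L' u b') := by
    refine Finset.prod_congr rfl fun b' hb' => ?_
    rw [Function.update_of_ne (Finset.ne_of_mem_erase hb'), (lat L L' b').chordCoeff_eq_sum]
  rw [hl] at h
  rw [h]
  refine Finset.sum_congr rfl fun P _ => Finset.sum_congr rfl fun Q _ => ?_
  have hu : (∏ b', Function.update (blockP L L' u) b v b' (P b')) =
      v (P b) * ∏ b' ∈ Finset.univ.erase b, blockP L L' u b' (P b') := by
    rw [← Finset.mul_prod_erase _ _ (Finset.mem_univ b), Function.update_self]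
    exact congrArg _ (Finset.prod_congr rfl fun b' hb' => by
      rw [Function.update_of_ne (Finset.ne_of_mem_erase hb')])
  rw [hu]
  simp only [lawA, thetaPnone, blockP_apply]

omit [Fintype β] [Fintype δ] in
/-- Segre expansion with one marked block carrying the correction tensor `c` instead of `a`:
`∑_{P,Q} c^{(M_b)}_{J_bK_b;P_bQ_b} ∏_{b'≠b} a_{…;P_{b'}Q_{b'}} Θ^P_P Θ^P_Q = γ^{(M_b)}_{J_bK_b}(P(t'_b)) ∏_{b'≠b} α(P(t'_{b'}))`.
[folklore] -/
theorem sum_lawC_marked (M J K : γ ⊕ γ' → Fin 3) (u : β ⊕ ((γ ⊕ γ') ⊕ δ) → ℂ) (b : γ ⊕ γ') :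
    ∑ P : γ ⊕ γ' → Fin 3, ∑ Q : γ ⊕ γ' → Fin 3,
        ((lat L L' b).chordC₂ (M b) (J b) (K b) (P b) (Q b) *
            ∏ b' ∈ Finset.univ.erase b, (lat L L' b').chordCoeff₂ (M b') (J b') (K b') (P b') (Q b')) *
          (thetaPnone (β := β) (δ := δ) L L' P u * thetaPnone (β := β) (δ := δ) L L' Q u) =
      (lat L L' b).chordCcoeff (M b) (J b) (K b) (blockP L L' u b) *
        ∏ b' ∈ Finset.univ.erase b, (lat L L' b').chordCoeff (M b') (J b') (K b') (blockP L L' u b') := by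
  have h := prod_sum_sum_eq
    (Function.update (fun b' l m => (lat L L' b').chordCoeff₂ (M b') (J b') (K b') l m) b
      (fun l m => (lat L L' b).chordC₂ (M b) (J b) (K b) l m))
    (blockP L L' u) (blockP L L' u)
  rw [← Finset.mul_prod_erase _ _ (Finset.mem_univ b), Function.update_self] at h
  have hl : ∏ b' ∈ Finset.univ.erase b, ∑ l : Fin 3, ∑ m : Fin 3,
      Function.update (fun b' l m => (lat L L' b').chordCoeff₂ (M b') (J b') (K b') l m) b
        (fun l m => (lat L L' b).chordC₂ (M b) (J b) (K b) l m) b' l m * (blockP L L' u b' l * blockP L L' u b' m) =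
      ∏ b' ∈ Finset.univ.erase b, (lat L L' b').chordCoeff (M b') (J b') (K b') (blockP L L' u b') := by
    refine Finset.prod_congr rfl fun b' hb' => ?_
    rw [Function.update_of_ne (Finset.ne_of_mem_erase hb'), (lat L L' b').chordCoeff_eq_sum]
  rw [hl] at h
  rw [show (lat L L' b).chordCcoeff (M b) (J b) (K b) (blockP L L' u b) =
      ∑ l : Fin 3, ∑ m : Fin 3, (lat L L' b).chordC₂ (M b) (J b) (K b) l m * (blockP L L' u b l * blockP L L' u b m)
    from rfl, h]
  refine Finset.sum_congr rfl fun P _ => Finset.sum_congr rfl fun Q _ => ?_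
  have hu : (∏ b', Function.update (fun b' l m => (lat L L' b').chordCoeff₂ (M b') (J b') (K b') l m) b
        (fun l m => (lat L L' b).chordC₂ (M b) (J b) (K b) l m) b' (P b') (Q b')) =
      (lat L L' b).chordC₂ (M b) (J b) (K b) (P b) (Q b) *
        ∏ b' ∈ Finset.univ.erase b, (lat L L' b').chordCoeff₂ (M b') (J b') (K b') (P b') (Q b') := by
    rw [← Finset.mul_prod_erase _ _ (Finset.mem_univ b), Function.update_self]
    exact congrArg _ (Finset.prod_congr rfl fun b' hb' => by
      rw [Function.update_of_ne (Finset.ne_of_mem_erase hb')])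
  rw [hu]
  simp only [thetaPnone, blockP_apply]

/-- Bringing the innermost of three sums outside. [folklore] -/
private theorem sum_comm₃ {α₁ α₂ α₃ : Type*} [Fintype α₁] [Fintype α₂] [Fintype α₃]
    (f : α₁ → α₂ → α₃ → ℂ) : ∑ x, ∑ y, ∑ z, f x y z = ∑ z, ∑ x, ∑ y, f x y z :=
  calc ∑ x, ∑ y, ∑ z, f x y z = ∑ x, ∑ z, ∑ y, f x y z :=
        Finset.sum_congr rfl fun _ _ => Finset.sum_comm
    _ = ∑ z, ∑ x, ∑ y, f x y z := Finset.sum_comm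

omit [Fintype β] [Fintype δ] in
/-- **The fibre coefficients as quadratic forms in `Θ(u)`**:
`d^e_{M;JK}(u) = ∑_{P,Q} A_{M;JK;PQ} Θ^P_{(P,some e)}(u) Θ^P_{(Q,none)}(u) + ∑_{P,Q} B^e_{M;JK;PQ} Θ^P_{(P,none)}(u) Θ^P_{(Q,none)}(u)`
— the `ζ(t'_b)`-terms of `d^e` are exactly those of the fibre sections at `u`, by the pair
antisymmetry of the chord tensor. [folklore] -/
theorem addCoeffS_eq_sum (M : γ ⊕ γ' → Fin 3) (e : δ) (J K : γ ⊕ γ' → Fin 3) (u : β ⊕ ((γ ⊕ γ') ⊕ δ) → ℂ) :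
    addCoeffS L L' κM M e J K u =
      ∑ P : γ ⊕ γ' → Fin 3, ∑ Q : γ ⊕ γ' → Fin 3,
          lawA L L' M J K P Q * (thetaPsome (β := β) L L' κM P e u * thetaPnone (β := β) (δ := δ) L L' Q u) +
        ∑ P : γ ⊕ γ' → Fin 3, ∑ Q : γ ⊕ γ' → Fin 3,
          lawB L L' κM M e J K P Q * (thetaPnone (β := β) (δ := δ) L L' P u * thetaPnone (β := β) (δ := δ) L L' Q u) := by
  -- the `A`-part: `u(is e) c(u) - ∑_b κ_{eb} (∑_{lm} a_{JK;lm} Z_l P_m)(t'_b) ∏_{b'≠b} α`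
  have h1 : ∑ P : γ ⊕ γ' → Fin 3, ∑ Q : γ ⊕ γ' → Fin 3,
      lawA L L' M J K P Q * (thetaPsome (β := β) L L' κM P e u * thetaPnone (β := β) (δ := δ) L L' Q u) =
      u (is e) * addCoeffP L L' M J K u -
        ∑ b, (κM e b : ℂ) * ((∑ l : Fin 3, ∑ m : Fin 3,
          (lat L L' b).chordCoeff₂ (M b) (J b) (K b) l m * (blockZ L L' u b l * blockP L L' u b m)) *
            ∏ b' ∈ Finset.univ.erase b, (lat L L' b').chordCoeff (M b') (J b') (K b') (blockP L L' u b')) := by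
    have hsplit : ∀ P Q : γ ⊕ γ' → Fin 3,
        lawA L L' M J K P Q * (thetaPsome (β := β) L L' κM P e u * thetaPnone (β := β) (δ := δ) L L' Q u) =
        u (is e) * (lawA L L' M J K P Q *
            (thetaPnone (β := β) (δ := δ) L L' P u * thetaPnone (β := β) (δ := δ) L L' Q u)) -
          ∑ b, (κM e b : ℂ) * (lawA L L' M J K P Q *
            ((blockZ L L' u b (P b) * ∏ b' ∈ Finset.univ.erase b, blockP L L' u b' (P b')) *
              thetaPnone (β := β) (δ := δ) L L' Q u)) := by
      intro P Q
      simp only [thetaPsome, ← blockZ_apply, ← blockP_apply, sub_mul, mul_sub, Finset.sum_mul,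
        Finset.mul_sum]
      congr 1
      · ring
      · exact Finset.sum_congr rfl fun b _ => by ring
    simp only [hsplit, Finset.sum_sub_distrib, ← Finset.mul_sum, ← addCoeffP_eq_sum]
    congr 1
    rw [sum_comm₃]
    refine Finset.sum_congr rfl fun b _ => ?_
    rw [← sum_lawA_marked L L' M J K u b (blockZ L L' u b)]
    simp only [Finset.mul_sum]
  -- the `B`-part: `-∑_b κ_{eb} γ(P(t'_b)) ∏_{b'≠b} α`
  have h2 : ∑ P : γ ⊕ γ' → Fin 3, ∑ Q : γ ⊕ γ' → Fin 3,
      lawB L L' κM M e J K P Q * (thetaPnone (β := β) (δ := δ) L L' P u * thetaPnone (β := β) (δ := δ) L L' Q u) =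
      -∑ b, (κM e b : ℂ) * ((lat L L' b).chordCcoeff (M b) (J b) (K b) (blockP L L' u b) *
        ∏ b' ∈ Finset.univ.erase b, (lat L L' b').chordCoeff (M b') (J b') (K b') (blockP L L' u b')) := by
    have hsplit : ∀ P Q : γ ⊕ γ' → Fin 3,
        lawB L L' κM M e J K P Q * (thetaPnone (β := β) (δ := δ) L L' P u * thetaPnone (β := β) (δ := δ) L L' Q u) =
        -∑ b, (κM e b : ℂ) * (((lat L L' b).chordC₂ (M b) (J b) (K b) (P b) (Q b) *
            ∏ b' ∈ Finset.univ.erase b, (lat L L' b').chordCoeff₂ (M b') (J b') (K b') (P b') (Q b')) *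
          (thetaPnone (β := β) (δ := δ) L L' P u * thetaPnone (β := β) (δ := δ) L L' Q u)) := by
      intro P Q
      simp only [lawB, neg_mul, Finset.sum_mul, neg_inj]
      exact Finset.sum_congr rfl fun b _ => by ring
    simp only [hsplit, Finset.sum_neg_distrib, neg_inj]
    rw [sum_comm₃]
    refine Finset.sum_congr rfl fun b _ => ?_
    rw [← sum_lawC_marked L L' M J K u b]
    simp only [Finset.mul_sum]
  -- the antisymmetry turns the `Z`-form of the `A`-part into the one of `d^e`
  have hkey : ∀ b, (∑ l : Fin 3, ∑ m : Fin 3,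
      (lat L L' b).chordCoeff₂ (M b) (J b) (K b) l m * (blockZ L L' u b l * blockP L L' u b m)) =
      -∑ j : Fin 3, ∑ k : Fin 3, (lat L L' b).chordCoeff₂ (M b) j k (J b) (K b) * (blockZ L L' u b j * blockP L L' u b k) := by
    intro b
    simp only [← Finset.sum_neg_distrib]
    refine Finset.sum_congr rfl fun l _ => Finset.sum_congr rfl fun m _ => ?_
    rw [(lat L L' b).chordCoeff₂_swap (M b) (J b) (K b) l m]
    ring
  rw [h1, h2]
  simp only [hkey, addCoeffS]
  rw [sub_eq_add_neg, add_assoc]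
  congr 1
  rw [← Finset.sum_neg_distrib, ← Finset.sum_neg_distrib, ← Finset.sum_add_distrib]
  exact Finset.sum_congr rfl fun b _ => by ring

/-! ### The bihomogeneous law on the theta functions -/

omit [Fintype β] [Fintype δ] in
/-- **The `(2,2)` addition law of the theta model, block coordinates**: for ALL `w, u`,
`μ(w,u) Θ_{(a,(M,none))}(w+u) = ∑_{J,K,P,Q} A_{M;JK;PQ} Θ_{(a,(J,none))}(w) Θ_{(none,(K,none))}(w) Θ_{(a,(P,none))}(u) Θ_{(none,(Q,none))}(u)`.
[cite: NesterenkoPhilippon2001, Ch. 11 §2.1 (84)] -/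
theorem theta_add_none₂ (a : Option β) (M : γ ⊕ γ' → Fin 3) (w u : β ⊕ ((γ ⊕ γ') ⊕ δ) → ℂ) :
    addUnit (β := β) (δ := δ) L L' w u * theta L L' κM (a, (M, none)) (w + u) =
      ∑ J : γ ⊕ γ' → Fin 3, ∑ K : γ ⊕ γ' → Fin 3, ∑ P : γ ⊕ γ' → Fin 3, ∑ Q : γ ⊕ γ' → Fin 3, lawA L L' M J K P Q *
        ((theta L L' κM (a, (J, none)) w * theta L L' κM (none, (K, none)) w) *
          (theta L L' κM (a, (P, none)) u * theta L L' κM (none, (Q, none)) u)) := by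
  rw [theta_add_none]
  refine Finset.sum_congr rfl fun J _ => Finset.sum_congr rfl fun K _ => ?_
  rw [addCoeffP_eq_sum, Finset.mul_sum, Finset.sum_mul]
  refine Finset.sum_congr rfl fun P _ => ?_
  rw [Finset.mul_sum, Finset.sum_mul]
  refine Finset.sum_congr rfl fun Q _ => ?_
  simp only [theta, thetaP_none, thetaT_none, one_mul]
  ring

omit [Fintype β] [Fintype δ] in
/-- **The `(2,2)` addition law of the theta model, fibre coordinates**: for ALL `w, u`,
`μ(w,u) Θ_{(a,(M,some e))}(w+u) = ∑ A·Θ_{(a,(J,some e))}(w)Θ^P_K(w)Θ_{(a,(P,none))}(u)Θ^P_Q(u)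
  + ∑ A·Θ_{(a,(J,none))}(w)Θ^P_K(w)Θ_{(a,(P,some e))}(u)Θ^P_Q(u) + ∑ B^e·Θ_{(a,(J,none))}(w)Θ^P_K(w)Θ_{(a,(P,none))}(u)Θ^P_Q(u)`.
[cite: NesterenkoPhilippon2001, Ch. 11 §2.1 (84)] -/
theorem theta_add_some₂ (a : Option β) (M : γ ⊕ γ' → Fin 3) (e : δ) (w u : β ⊕ ((γ ⊕ γ') ⊕ δ) → ℂ) :
    addUnit (β := β) (δ := δ) L L' w u * theta L L' κM (a, (M, some e)) (w + u) =
      ∑ J : γ ⊕ γ' → Fin 3, ∑ K : γ ⊕ γ' → Fin 3, ∑ P : γ ⊕ γ' → Fin 3, ∑ Q : γ ⊕ γ' → Fin 3,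
        (lawA L L' M J K P Q *
            ((theta L L' κM (a, (J, some e)) w * theta L L' κM (none, (K, none)) w) *
              (theta L L' κM (a, (P, none)) u * theta L L' κM (none, (Q, none)) u)) +
          lawA L L' M J K P Q *
            ((theta L L' κM (a, (J, none)) w * theta L L' κM (none, (K, none)) w) *
              (theta L L' κM (a, (P, some e)) u * theta L L' κM (none, (Q, none)) u)) +
          lawB L L' κM M e J K P Q *
            ((theta L L' κM (a, (J, none)) w * theta L L' κM (none, (K, none)) w) *
              (theta L L' κM (a, (P, none)) u * theta L L' κM (none, (Q, none)) u))) := by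
  rw [theta_add_some, ← Finset.sum_add_distrib]
  refine Finset.sum_congr rfl fun J _ => ?_
  rw [← Finset.sum_add_distrib]
  refine Finset.sum_congr rfl fun K _ => ?_
  rw [addCoeffP_eq_sum, addCoeffS_eq_sum]
  simp only [Finset.mul_sum, Finset.sum_mul, mul_add, add_mul, ← Finset.sum_add_distrib]
  refine Finset.sum_congr rfl fun P _ => Finset.sum_congr rfl fun Q _ => ?_
  simp only [theta, thetaP_none, thetaP_some, thetaT_none, one_mul]
  ring

/-! ### The law as polynomials in two sets of theta variables -/

/-- **The `(2,2)` addition law of the theta model as polynomials with constant coefficients**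
`A_I(X, Y) ∈ ℂ[X_J, Y_J]`: `A_I(Θ(w), Θ(u)) = μ(w, u) Θ_I(w + u)` (`eval_bilaw`).
[cite: NesterenkoPhilippon2001, Ch. 11 §2.1 (84)] -/
def bilaw : Option β × ThetaIdx (γ ⊕ γ') δ →
    MvPolynomial ((Option β × ThetaIdx (γ ⊕ γ') δ) ⊕ (Option β × ThetaIdx (γ ⊕ γ') δ)) ℂ
  | (a, (M, none)) => ∑ J : γ ⊕ γ' → Fin 3, ∑ K : γ ⊕ γ' → Fin 3, ∑ P : γ ⊕ γ' → Fin 3, ∑ Q : γ ⊕ γ' → Fin 3,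
      C (lawA L L' M J K P Q) *
        ((X (Sum.inl (a, (J, none))) * X (Sum.inl (none, (K, none)))) *
          (X (Sum.inr (a, (P, none))) * X (Sum.inr (none, (Q, none)))))
  | (a, (M, some e)) => ∑ J : γ ⊕ γ' → Fin 3, ∑ K : γ ⊕ γ' → Fin 3, ∑ P : γ ⊕ γ' → Fin 3, ∑ Q : γ ⊕ γ' → Fin 3,
      (C (lawA L L' M J K P Q) *
          ((X (Sum.inl (a, (J, some e))) * X (Sum.inl (none, (K, none)))) *
            (X (Sum.inr (a, (P, none))) * X (Sum.inr (none, (Q, none))))) +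
        C (lawA L L' M J K P Q) *
          ((X (Sum.inl (a, (J, none))) * X (Sum.inl (none, (K, none)))) *
            (X (Sum.inr (a, (P, some e))) * X (Sum.inr (none, (Q, none))))) +
        C (lawB L L' κM M e J K P Q) *
          ((X (Sum.inl (a, (J, none))) * X (Sum.inl (none, (K, none)))) *
            (X (Sum.inr (a, (P, none))) * X (Sum.inr (none, (Q, none))))))

omit [Fintype β] [Fintype δ] in
/-- **`A_I(Θ(w), Θ(u)) = μ(w, u) Θ_I(w + u)`** for ALL `w, u`. [cite: NesterenkoPhilippon2001, Ch. 11 §2.1 (84)] -/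
theorem eval_bilaw (I : Option β × ThetaIdx (γ ⊕ γ') δ) (w u : β ⊕ ((γ ⊕ γ') ⊕ δ) → ℂ) :
    eval (Sum.elim (fun J => theta L L' κM J w) fun J => theta L L' κM J u) (bilaw L L' κM I) =
      addUnit (β := β) (δ := δ) L L' w u * theta L L' κM I (w + u) := by
  obtain ⟨a, M, _ | e⟩ := I
  · rw [theta_add_none₂]
    simp [bilaw, map_sum, map_mul, eval_C, eval_X]
  · rw [theta_add_some₂]
    simp [bilaw, map_sum, map_mul, map_add, eval_C, eval_X]

omit [Fintype β] [Fintype δ] in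
/-- The law has degree `2` in `X`. [folklore] -/
theorem bilaw_isWeightedHomogeneous_wX (I : Option β × ThetaIdx (γ ⊕ γ') δ) :
    IsWeightedHomogeneous (wX (Option β × ThetaIdx (γ ⊕ γ') δ)) (bilaw L L' κM I) 2 := by
  have key : ∀ (c : ℂ) (i₁ i₂ i₃ i₄ : Option β × ThetaIdx (γ ⊕ γ') δ),
      IsWeightedHomogeneous (wX (Option β × ThetaIdx (γ ⊕ γ') δ))
        (C c * ((X (Sum.inl i₁) * X (Sum.inl i₂)) * (X (Sum.inr i₃) * X (Sum.inr i₄))) :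
          MvPolynomial ((Option β × ThetaIdx (γ ⊕ γ') δ) ⊕ (Option β × ThetaIdx (γ ⊕ γ') δ)) ℂ) 2 :=
    fun c i₁ i₂ i₃ i₄ => isWeightedHomogeneous_CXXXX (wX _) c (Sum.inl i₁) (Sum.inl i₂) (Sum.inr i₃) (Sum.inr i₄)
  obtain ⟨a, M, _ | e⟩ := I
  · exact IsWeightedHomogeneous.sum _ _ _ fun J _ => IsWeightedHomogeneous.sum _ _ _ fun K _ =>
      IsWeightedHomogeneous.sum _ _ _ fun P _ => IsWeightedHomogeneous.sum _ _ _ fun Q _ => key _ _ _ _ _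
  · exact IsWeightedHomogeneous.sum _ _ _ fun J _ => IsWeightedHomogeneous.sum _ _ _ fun K _ =>
      IsWeightedHomogeneous.sum _ _ _ fun P _ => IsWeightedHomogeneous.sum _ _ _ fun Q _ =>
        ((key _ _ _ _ _).add (key _ _ _ _ _)).add (key _ _ _ _ _)

omit [Fintype β] [Fintype δ] in
/-- The law has degree `2` in `Y`. [folklore] -/
theorem bilaw_isWeightedHomogeneous_wY (I : Option β × ThetaIdx (γ ⊕ γ') δ) :
    IsWeightedHomogeneous (wY (Option β × ThetaIdx (γ ⊕ γ') δ)) (bilaw L L' κM I) 2 := by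
  have key : ∀ (c : ℂ) (i₁ i₂ i₃ i₄ : Option β × ThetaIdx (γ ⊕ γ') δ),
      IsWeightedHomogeneous (wY (Option β × ThetaIdx (γ ⊕ γ') δ))
        (C c * ((X (Sum.inl i₁) * X (Sum.inl i₂)) * (X (Sum.inr i₃) * X (Sum.inr i₄))) :
          MvPolynomial ((Option β × ThetaIdx (γ ⊕ γ') δ) ⊕ (Option β × ThetaIdx (γ ⊕ γ') δ)) ℂ) 2 :=
    fun c i₁ i₂ i₃ i₄ => isWeightedHomogeneous_CXXXX (wY _) c (Sum.inl i₁) (Sum.inl i₂) (Sum.inr i₃) (Sum.inr i₄)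
  obtain ⟨a, M, _ | e⟩ := I
  · exact IsWeightedHomogeneous.sum _ _ _ fun J _ => IsWeightedHomogeneous.sum _ _ _ fun K _ =>
      IsWeightedHomogeneous.sum _ _ _ fun P _ => IsWeightedHomogeneous.sum _ _ _ fun Q _ => key _ _ _ _ _
  · exact IsWeightedHomogeneous.sum _ _ _ fun J _ => IsWeightedHomogeneous.sum _ _ _ fun K _ =>
      IsWeightedHomogeneous.sum _ _ _ fun P _ => IsWeightedHomogeneous.sum _ _ _ fun Q _ =>
        ((key _ _ _ _ _).add (key _ _ _ _ _)).add (key _ _ _ _ _)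

/-! ### The composite laws through an auxiliary point (constant coefficients, degree `4`) -/

/-- **The composite law through the auxiliary point `s`**:
`A^{(s)}_I(X, Y) = A_I(Q^{(-s)}(X), Q^{(s)}(Y))`, where `Q^{(u)}_J ∈ ℂ[X]₂` is the specialised law of
`PkappaThetaAdditionPoly.lean` (`Q^{(u)}_J(Θ(w)) = μ(w,u) Θ_J(w+u)`): a polynomial in `(X, Y)` with
constant coefficients, of degree `4` in `X` (and in `Y`), computing `Θ_I(w + z)` through the
intermediate points `w - s`, `z + s`. [cite: NesterenkoPhilippon2001, Ch. 11 §2.1 (complete systems)] -/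
def claw (s : β ⊕ ((γ ⊕ γ') ⊕ δ) → ℂ) (I : Option β × ThetaIdx (γ ⊕ γ') δ) :
    MvPolynomial ((Option β × ThetaIdx (γ ⊕ γ') δ) ⊕ (Option β × ThetaIdx (γ ⊕ γ') δ)) ℂ :=
  bind₁ (Sum.elim (fun I' => rename Sum.inl (addPoly L L' κM (-s) I'))
    fun I' => rename Sum.inr (addPoly L L' κM s I')) (bilaw L L' κM I)

/-- **The unit of the composite law**: `U_s(w, z) = μ(w, -s)² μ(z, s)² μ(w - s, z + s)`. [folklore] -/
def clawUnit (s w z : β ⊕ ((γ ⊕ γ') ⊕ δ) → ℂ) : ℂ :=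
  addUnit (β := β) (δ := δ) L L' w (-s) ^ 2 * addUnit (β := β) (δ := δ) L L' z s ^ 2 *
    addUnit (β := β) (δ := δ) L L' (w - s) (z + s)

omit [Fintype β] [Fintype δ] in
/-- The composite law has degree `4` in `X`. [folklore] -/
theorem claw_isWeightedHomogeneous (s : β ⊕ ((γ ⊕ γ') ⊕ δ) → ℂ) (I : Option β × ThetaIdx (γ ⊕ γ') δ) :
    IsWeightedHomogeneous (Sum.elim (fun _ => (1 : ℕ)) fun _ => 0) (claw L L' κM s I) 4 :=
  (bilaw_isWeightedHomogeneous_wX L L' κM I).bind₁_of_weights 2 (by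
    rintro (I' | I')
    · exact isWeightedHomogeneous_wX_rename_inl (addPoly_isHomogeneous L L' κM (-s) I')
    · exact isWeightedHomogeneous_wX_rename_inr _)

omit [Fintype β] [Fintype δ] in
/-- The composite law has degree `4` in `Y` as well. [folklore] -/
theorem claw_isWeightedHomogeneous_wY (s : β ⊕ ((γ ⊕ γ') ⊕ δ) → ℂ) (I : Option β × ThetaIdx (γ ⊕ γ') δ) :
    IsWeightedHomogeneous (Sum.elim (fun _ => (0 : ℕ)) fun _ => 1) (claw L L' κM s I) 4 :=
  (bilaw_isWeightedHomogeneous_wY L L' κM I).bind₁_of_weights 2 (by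
    rintro (I' | I')
    · exact isWeightedHomogeneous_wY_rename_inl _
    · exact isWeightedHomogeneous_wY_rename_inr (addPoly_isHomogeneous L L' κM s I'))

omit [Fintype β] [Fintype δ] in
/-- **`A^{(s)}_I(Θ(w), Θ(z)) = U_s(w, z) Θ_I(w + z)`** for ALL `w, z` and every auxiliary `s`.
[cite: NesterenkoPhilippon2001, Ch. 11 §2.1 (84)] -/
theorem eval_claw (s : β ⊕ ((γ ⊕ γ') ⊕ δ) → ℂ) (I : Option β × ThetaIdx (γ ⊕ γ') δ) (w z : β ⊕ ((γ ⊕ γ') ⊕ δ) → ℂ) :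
    eval (Sum.elim (fun J => theta L L' κM J w) fun J => theta L L' κM J z) (claw L L' κM s I) =
      clawUnit (β := β) (δ := δ) L L' s w z * theta L L' κM I (w + z) := by
  have hX : ∀ I', eval (Sum.elim (fun J => theta L L' κM J w) fun J => theta L L' κM J z)
      (rename Sum.inl (addPoly L L' κM (-s) I')) = addUnit (β := β) (δ := δ) L L' w (-s) * theta L L' κM I' (w - s) := by
    intro I'
    rw [eval_rename, sub_eq_add_neg]
    exact thetaEval_addPoly L L' κM (-s) I' w
  have hY : ∀ I', eval (Sum.elim (fun J => theta L L' κM J w) fun J => theta L L' κM J z)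
      (rename Sum.inr (addPoly L L' κM s I')) = addUnit (β := β) (δ := δ) L L' z s * theta L L' κM I' (z + s) := by
    intro I'
    rw [eval_rename]
    exact thetaEval_addPoly L L' κM s I' z
  rw [claw, eval_bind₁]
  have hfun : (fun i => eval (Sum.elim (fun J => theta L L' κM J w) fun J => theta L L' κM J z)
      (Sum.elim (fun I' => rename Sum.inl (addPoly L L' κM (-s) I'))
        (fun I' => rename Sum.inr (addPoly L L' κM s I')) i)) =
      fun i => addUnit (β := β) (δ := δ) L L' w (-s) ^ wX (Option β × ThetaIdx (γ ⊕ γ') δ) i *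
        (addUnit (β := β) (δ := δ) L L' z s ^ wY (Option β × ThetaIdx (γ ⊕ γ') δ) i *
          Sum.elim (fun I' => theta L L' κM I' (w - s)) (fun I' => theta L L' κM I' (z + s)) i) := by
    funext i
    rcases i with I' | I'
    · simp [hX]
    · simp [hY]
  rw [hfun, eval_pow_weight_mul_of_isWeightedHomogeneous (bilaw_isWeightedHomogeneous_wX L L' κM I),
    eval_pow_weight_mul_of_isWeightedHomogeneous (bilaw_isWeightedHomogeneous_wY L L' κM I), eval_bilaw,
    clawUnit, show w - s + (z + s) = w + z by abel]
  ring

omit [Fintype β] [Fintype δ] [DecidableEq γ] [DecidableEq γ'] in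
/-- **Where the composite law is good**: `U_s(w, z) ≠ 0` iff, for every block `b`,
`w_b + s_b ∉ Λ`, `z_b - s_b ∉ Λ` and `w_b - s_b - (z_b + s_b) ∉ Λ`. [folklore] -/
theorem clawUnit_ne_zero_iff (s w z : β ⊕ ((γ ⊕ γ') ⊕ δ) → ℂ) :
    clawUnit (β := β) (δ := δ) L L' s w z ≠ 0 ↔
      (∀ b, w (iz b) + s (iz b) ∉ (lat L L' b).lattice) ∧ (∀ b, z (iz b) - s (iz b) ∉ (lat L L' b).lattice) ∧
        ∀ b, w (iz b) - s (iz b) - (z (iz b) + s (iz b)) ∉ (lat L L' b).lattice := by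
  rw [clawUnit, mul_ne_zero_iff, mul_ne_zero_iff, pow_ne_zero_iff two_ne_zero,
    pow_ne_zero_iff two_ne_zero, addUnit_ne_zero_iff, addUnit_ne_zero_iff, addUnit_ne_zero_iff]
  simp only [Pi.neg_apply, sub_neg_eq_add, Pi.sub_apply, Pi.add_apply, and_assoc]

omit [Fintype β] [Fintype δ] [DecidableEq γ] [DecidableEq γ'] in
/-- The composite law is bad at `(w, z)` iff some block is on one of the three diagonals. [folklore] -/
theorem clawUnit_eq_zero_iff (s w z : β ⊕ ((γ ⊕ γ') ⊕ δ) → ℂ) :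
    clawUnit (β := β) (δ := δ) L L' s w z = 0 ↔
      ∃ b, w (iz b) + s (iz b) ∈ (lat L L' b).lattice ∨ z (iz b) - s (iz b) ∈ (lat L L' b).lattice ∨
        w (iz b) - s (iz b) - (z (iz b) + s (iz b)) ∈ (lat L L' b).lattice := by
  have h := clawUnit_ne_zero_iff (β := β) (δ := δ) L L' s w z
  constructor
  · intro h0
    by_contra hne
    push Not at hne
    exact (h.mpr ⟨fun b => (hne b).1, fun b => (hne b).2.1, fun b => (hne b).2.2⟩) h0
  · rintro ⟨b, hb⟩
    by_contra h0
    obtain ⟨h1, h2, h3⟩ := h.mp h0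
    rcases hb with hb | hb | hb
    exacts [h1 b hb, h2 b hb, h3 b hb]

/-! ### Holomorphy of the unit -/

omit [DecidableEq γ] [DecidableEq γ'] in
/-- `μ(f(q), g(q))` is analytic in `q` for analytic `f, g`. [folklore] -/
theorem analyticAt_addUnit_comp {E : Type*} [NormedAddCommGroup E] [NormedSpace ℂ E]
    {f g : E → β ⊕ ((γ ⊕ γ') ⊕ δ) → ℂ} {q : E} (hf : AnalyticAt ℂ f q) (hg : AnalyticAt ℂ g q) :
    AnalyticAt ℂ (fun q => addUnit (β := β) (δ := δ) L L' (f q) (g q)) q := by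
  unfold addUnit
  refine Finset.analyticAt_fun_prod _ fun b _ => ?_
  have hπ : AnalyticAt ℂ (fun w : β ⊕ ((γ ⊕ γ') ⊕ δ) → ℂ => w (iz b)) (f q) :=
    (ContinuousLinearMap.proj (R := ℂ) (φ := fun _ : β ⊕ ((γ ⊕ γ') ⊕ δ) => ℂ) (iz b)).analyticAt _
  have hπ' : AnalyticAt ℂ (fun w : β ⊕ ((γ ⊕ γ') ⊕ δ) → ℂ => w (iz b)) (g q) :=
    (ContinuousLinearMap.proj (R := ℂ) (φ := fun _ : β ⊕ ((γ ⊕ γ') ⊕ δ) => ℂ) (iz b)).analyticAt _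
  have hc : AnalyticAt ℂ (fun q => f q (iz b) - g q (iz b)) q := (hπ.comp hf).sub (hπ'.comp hg)
  exact ((((lat L L' b).differentiable_weierstrassSigma_holds).analyticAt _).comp hc).pow 3 |>.neg

omit [DecidableEq γ] [DecidableEq γ'] in
/-- **The unit of the composite law is entire on `V × V`.** [folklore] -/
theorem analyticOnNhd_clawUnit (s : β ⊕ ((γ ⊕ γ') ⊕ δ) → ℂ) :
    AnalyticOnNhd ℂ (Function.uncurry (clawUnit (β := β) (δ := δ) L L' s)) univ := by
  intro p _
  have h1 : AnalyticAt ℂ (fun q : (β ⊕ ((γ ⊕ γ') ⊕ δ) → ℂ) × (β ⊕ ((γ ⊕ γ') ⊕ δ) → ℂ) =>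
      addUnit (β := β) (δ := δ) L L' q.1 (-s)) p :=
    analyticAt_addUnit_comp L L' analyticAt_fst analyticAt_const
  have h2 : AnalyticAt ℂ (fun q : (β ⊕ ((γ ⊕ γ') ⊕ δ) → ℂ) × (β ⊕ ((γ ⊕ γ') ⊕ δ) → ℂ) =>
      addUnit (β := β) (δ := δ) L L' q.2 s) p :=
    analyticAt_addUnit_comp L L' analyticAt_snd analyticAt_const
  have hf : AnalyticAt ℂ (fun q : (β ⊕ ((γ ⊕ γ') ⊕ δ) → ℂ) × (β ⊕ ((γ ⊕ γ') ⊕ δ) → ℂ) => q.1 - s) p :=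
    analyticAt_fst.fun_sub analyticAt_const
  have hg : AnalyticAt ℂ (fun q : (β ⊕ ((γ ⊕ γ') ⊕ δ) → ℂ) × (β ⊕ ((γ ⊕ γ') ⊕ δ) → ℂ) => q.2 + s) p :=
    analyticAt_snd.fun_add analyticAt_const
  have h3 : AnalyticAt ℂ (fun q : (β ⊕ ((γ ⊕ γ') ⊕ δ) → ℂ) × (β ⊕ ((γ ⊕ γ') ⊕ δ) → ℂ) =>
      addUnit (β := β) (δ := δ) L L' (q.1 - s) (q.2 + s)) p :=
    analyticAt_addUnit_comp L L' hf hg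
  show AnalyticAt ℂ (fun q : (β ⊕ ((γ ⊕ γ') ⊕ δ) → ℂ) × (β ⊕ ((γ ⊕ γ') ⊕ δ) → ℂ) =>
    addUnit (β := β) (δ := δ) L L' q.1 (-s) ^ 2 * addUnit (β := β) (δ := δ) L L' q.2 s ^ 2 *
      addUnit (β := β) (δ := δ) L L' (q.1 - s) (q.2 + s)) p
  exact ((h1.fun_pow 2).fun_mul (h2.fun_pow 2)).fun_mul h3

/-! ### Completeness with finitely many auxiliary points -/

omit [Fintype β] [Fintype δ] [DecidableEq γ] [DecidableEq γ'] in
/-- **A generic scalar**: `c` with `2kc ∉ Λ_b` for `0 < k < m` and every block `b` (countably many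
exclusions). [folklore] -/
theorem exists_generic_scalar (m : ℕ) :
    ∃ c : ℂ, ∀ (b : γ ⊕ γ') (k : ℕ), 0 < k → k < m → 2 * (k : ℂ) * c ∉ (lat L L' b).lattice := by
  have hbad : (⋃ b : γ ⊕ γ', ⋃ k ∈ Finset.range m,
      (fun l : ℂ => l / (2 * (k : ℂ))) '' ((lat L L' b).lattice : Set ℂ)).Countable :=
    Set.countable_iUnion fun b => Set.Countable.biUnion (Finset.countable_toSet _) fun k _ =>
      (lattice_countable (lat L L' b)).image _
  obtain ⟨c, hc⟩ := (hbad.dense_compl ℂ).nonempty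
  refine ⟨c, fun b k hk hkm hmem => hc ?_⟩
  simp only [Set.mem_iUnion, Set.mem_image, Finset.mem_range, SetLike.mem_coe]
  refine ⟨b, k, hkm, _, hmem, ?_⟩
  have hk' : (k : ℂ) ≠ 0 := Nat.cast_ne_zero.mpr hk.ne'
  field_simp

omit [Fintype β] [Fintype δ] [DecidableEq γ] [DecidableEq γ'] in
/-- **Completeness by pigeonhole.** If `3|γ| < m` and `2kc ∉ Λ` for `0 < k < m`, then at every
`(w, z)` one of the composite laws through `s^{(0)}, …, s^{(m-1)}` is good: two laws `i ≠ j` bad for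
the same reason on the same block `b` would give `2(i - j)c ∈ Λ`.
[cite: NesterenkoPhilippon2001, Ch. 11 §2.1 (complete systems exist)] -/
theorem exists_clawUnit_clawPt_ne_zero {m : ℕ} (hm : 3 * Fintype.card (γ ⊕ γ') < m) {c : ℂ}
    (hc : ∀ (b : γ ⊕ γ') (k : ℕ), 0 < k → k < m → 2 * (k : ℂ) * c ∉ (lat L L' b).lattice)
    (w z : β ⊕ ((γ ⊕ γ') ⊕ δ) → ℂ) :
    ∃ i : Fin m, clawUnit (β := β) (δ := δ) L L' (clawPt c i) w z ≠ 0 := by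
  by_contra hall
  push Not at hall
  -- the reason `(block, type)` for which law `i` is bad, encoded in three copies of `γ ⊕ γ'`
  have hw : ∀ i : Fin m, ∃ t : (γ ⊕ γ') ⊕ ((γ ⊕ γ') ⊕ (γ ⊕ γ')),
      Sum.elim (fun b => w (iz b) + ((i : ℕ) : ℂ) * c ∈ (lat L L' b).lattice)
        (Sum.elim (fun b => z (iz b) - ((i : ℕ) : ℂ) * c ∈ (lat L L' b).lattice)
          fun b => w (iz b) - ((i : ℕ) : ℂ) * c - (z (iz b) + ((i : ℕ) : ℂ) * c) ∈ (lat L L' b).lattice) t := by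
    intro i
    have h0 := hall i
    rw [clawUnit_eq_zero_iff] at h0
    obtain ⟨b, h | h | h⟩ := h0
    · exact ⟨Sum.inl b, by simpa using h⟩
    · exact ⟨Sum.inr (Sum.inl b), by simpa using h⟩
    · exact ⟨Sum.inr (Sum.inr b), by simpa using h⟩
  choose f hf using hw
  obtain ⟨i, j, hij, hfij⟩ := Fintype.exists_ne_map_eq_of_card_lt f (by
    simp only [Fintype.card_sum, Fintype.card_fin] at hm ⊢
    omega)
  have key : ∃ b : γ ⊕ γ', 2 * (((i : ℕ) : ℂ) - ((j : ℕ) : ℂ)) * c ∈ (lat L L' b).lattice := by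
    have hi := hf i
    have hj := hf j
    rw [hfij] at hi
    generalize f j = t at hi hj
    rcases t with b | b | b
    · simp only [Sum.elim_inl] at hi hj
      have h := (lat L L' b).lattice.sub_mem hi hj
      have h2 := (lat L L' b).lattice.add_mem h h
      refine ⟨b, ?_⟩
      convert h2 using 1
      ring
    · simp only [Sum.elim_inr, Sum.elim_inl] at hi hj
      have h := (lat L L' b).lattice.sub_mem hj hi
      have h2 := (lat L L' b).lattice.add_mem h h
      refine ⟨b, ?_⟩
      convert h2 using 1
      ring
    · simp only [Sum.elim_inr] at hi hj
      have h := (lat L L' b).lattice.sub_mem hj hi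
      refine ⟨b, ?_⟩
      convert h using 1
      ring
  obtain ⟨b, key⟩ := key
  rcases Nat.lt_or_gt_of_ne (Fin.val_ne_of_ne hij) with h | h
  · refine hc b (j - i) (Nat.sub_pos_of_lt h) (by omega) ?_
    have hneg := (lat L L' b).lattice.neg_mem key
    convert hneg using 1
    push_cast [Nat.cast_sub h.le]
    ring
  · refine hc b (i - j) (Nat.sub_pos_of_lt h) (by omega) ?_
    convert key using 1
    push_cast [Nat.cast_sub h.le]
    ring

/-- A generic scalar for `3|γ| + 1` laws (chosen once). [folklore] -/
def clawScalar : ℂ := Classical.choose (exists_generic_scalar (γ := γ) (γ' := γ') L L' (nClaw (γ ⊕ γ')))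

omit [DecidableEq γ] [DecidableEq γ'] in
/-- The defining property of `clawScalar`. [folklore] -/
theorem clawScalar_spec : ∀ (b : γ ⊕ γ') (k : ℕ), 0 < k → k < nClaw (γ ⊕ γ') →
    2 * (k : ℂ) * clawScalar (γ := γ) (γ' := γ') L L' ∉ (lat L L' b).lattice :=
  Classical.choose_spec (exists_generic_scalar (γ := γ) (γ' := γ') L L' (nClaw (γ ⊕ γ')))

/-- **The auxiliary points of the complete system.** [folklore] -/
def clawFamily (i : Fin (nClaw (γ ⊕ γ'))) : β ⊕ ((γ ⊕ γ') ⊕ δ) → ℂ := clawPt (clawScalar (γ := γ) (γ' := γ') L L') i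

omit [Fintype β] [Fintype δ] [DecidableEq γ] [DecidableEq γ'] in
/-- **Completeness of the system**: at every `(w, z)` some `U_{s^{(i)}}(w, z) ≠ 0`.
[cite: NesterenkoPhilippon2001, Ch. 11 §2.1] -/
theorem exists_clawUnit_clawFamily_ne_zero (w z : β ⊕ ((γ ⊕ γ') ⊕ δ) → ℂ) :
    ∃ i : Fin (nClaw (γ ⊕ γ')), clawUnit (β := β) (δ := δ) L L' (clawFamily (β := β) (δ := δ) L L' i) w z ≠ 0 :=
  exists_clawUnit_clawPt_ne_zero L L' (Nat.lt_succ_self _) (clawScalar_spec L L') w z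

/-- **A complete system of addition laws for the theta model of `M_κ`** in the shape of the
fields `law / degree_law / lam / analyticOnNhd_lam / eval_law / exists_lam_ne_zero` of
`AnalyticGroupModel` (`ZeroEstModel.lean`), indexed by the theta indices: finitely many families
of polynomials in `(X, Y)` with constant coefficients, of degree `4` in `X`, computing
`Θ_I(w + z)` up to entire units without common zero on `V × V`.
[cite: NesterenkoPhilippon2001, Ch. 11 §2.1 (84)] -/
theorem exists_complete_addition_laws :
    ∃ (n : ℕ) (S : Fin n → β ⊕ ((γ ⊕ γ') ⊕ δ) → ℂ),
      (∀ i I, IsWeightedHomogeneous (Sum.elim (fun _ => (1 : ℕ)) fun _ => 0) (claw L L' κM (S i) I) 4) ∧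
      (∀ i, AnalyticOnNhd ℂ (Function.uncurry (clawUnit (β := β) (δ := δ) L L' (S i))) univ) ∧
      (∀ i I (w z : β ⊕ ((γ ⊕ γ') ⊕ δ) → ℂ),
        eval (Sum.elim (fun J => theta L L' κM J w) fun J => theta L L' κM J z) (claw L L' κM (S i) I) =
          clawUnit (β := β) (δ := δ) L L' (S i) w z * theta L L' κM I (w + z)) ∧
      ∀ w z : β ⊕ ((γ ⊕ γ') ⊕ δ) → ℂ, ∃ i, clawUnit (β := β) (δ := δ) L L' (S i) w z ≠ 0 :=
  ⟨nClaw (γ ⊕ γ'), clawFamily (β := β) (δ := δ) L L',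
    fun i I => claw_isWeightedHomogeneous L L' κM (clawFamily (β := β) (δ := δ) L L' i) I,
    fun i => analyticOnNhd_clawUnit L L' (clawFamily (β := β) (δ := δ) L L' i),
    fun i I w z => eval_claw L L' κM (clawFamily (β := β) (δ := δ) L L' i) I w z,
    exists_clawUnit_clawFamily_ne_zero L L'⟩

end Std

end GaGmEE

end Literature.NumberTheory.Transcendental

end
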